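import Literature.Barriers.Parity.SiegelZeroPrimePairs
import Literature.NumberTheory.Sieve.SmoothPlateauCutoff
import Literature.NumberTheory.Sieve.SingularSeriesMultiplesMean
import HarnessLib

/-!
# Matomäki–Merikoski, Theorem 1.3: the smoothing and dyadic reduction of §2, proved

Sibling of `Literature/Barriers/Parity/SiegelZeroPrimePairs.lean` (the catalogue entry vendoring
Matomäki–Merikoski, *Siegel zeros, twin primes, Goldbach's conjecture, and primes in short
intervals* (IMRN 2023; arXiv:2112.11412), Theorem 1.3 as the named fact
`Literature.Barriers.Parity.MatomakiMerikoski2023_pairCorrelation`). The proof of Theorem 1.3 opens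
(§2 "Initial steps") with a reduction to a smoothed dyadic statement:

> "Let `δ = X^{−ε}` for some small `ε > 0` and let `g : ℝ → [0, 1]` be a smooth function that is
> supported on `[1, 2]` and equals `1` on `[1 + δ, 2 − δ]`. Assume further that the derivatives of
> `g` satisfy `g^{(j)}(x) ≪ δ^{−j}` for every `x`. In case of Theorem 1.3 we first decompose the
> summation condition `n ≤ X` dyadically into conditions `n ∈ (x, 2x]` with `x ≤ X/2`. We estimate
> the contribution of `x ≤ X^{1−ε/4}` trivially, and for the remaining `x` we replace the condition
> `1_{n ∈ (x, 2x]}` by `g(n/x)` with an error term `O(δx log² X) = O(X^{1−ε/2})`. Thus it suffices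
> to show that `∑_n g(n/X)Λ(n)Λ(n + h) = ∫ g(y/X) dy · 𝔖_h (1 + 1_{φ(2^r) ∣ h}(−1)^{h/φ(2^r)}
> ∏_{p ∣ q', p ∤ h} (−1)/(p − 2)) + O_{C,ε}((h/φ(h)) X (exp(−C√(V log η)) +
> exp(−C (log X)^{3/5−ε}) + V log⁶η/η))` whenever `0 < h ≤ X^{1+ε/2}`."

This file PROVES that reduction: `MatomakiMerikoski2023_pairCorrelation_of_smoothed` derives the
named fact from the displayed smoothed statement, taken as an explicit hypothesis (no new named
fact is introduced) in the following concrete form — the weight is the tree's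
`plateauCutoff (1 + δ) (2 − δ) δ` (`SmoothPlateauCutoff.lean`: smooth, `= 1` on `[1 + δ, 2 − δ]`,
`= 0` off `(1, 2)`, `|g^{(j)}| ≤ 2K_j δ^{−j}`), the scale `x` is any real `x ≥ q^8` with
`V = log x/log q` in the error, `δ` is any number with `x^{−1/50}/4 ≤ δ ≤ 1/2`, and the shift
ranges over `1 ≤ h ≤ A x^{1+1/100}` (these explicit ranges replace the source's "small `ε`"; the
reduction uses `δ = X^{−1/100}/2`, dyadic scales `x ≥ X^{1−1/400}/2` and `h ≤ AX ≤ 3A x^{1+1/100}`).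
Everything else is elementary and PROVED here: `|Λ(n)Λ(n+h)| ≤ log² (2X + h)`, the dyadic
decomposition, the count `≤ 2δx + 2` of integers where `g(n/x) ≠ 1_{(x,2x]}(n)`,
`∑_j x_j ∫g = X + O(X^{1−1/400} + δX)` with `1 − 2δ ≤ ∫ g ≤ 1`, the harmless factors
`|corr| ≤ 1` and `𝔖_h ≤ 5 h/φ(h)`, the comparison of the error functions at the scales `x_j` and
`X` (`V_j ≥ 0.89 V`, with `C ↦ 2C`), and the absorption
`X^{−1/1000} ≪_{C,ε} exp(−C (log X)^{3/5−ε})` of all power savings.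

## References

* K. Matomäki, J. Merikoski, IMRN 2023:23, 20337–20384 (arXiv:2112.11412), §2 "Initial steps",
  first two paragraphs; §7, first paragraph. [cite: MatomakiMerikoski2023, §2]
-/

noncomputable section

open Finset Real
open scoped ArithmeticFunction.vonMangoldt

namespace Literature.Barriers.Parity

open Literature.NumberTheory.Sieve (goldbachSingularSeries plateauCutoff twinPrimeConst
  plateauCutoff_eq_one plateauCutoff_eq_zero_of_le plateauCutoff_eq_zero_of_ge plateauCutoff_nonneg
  plateauCutoff_le_one sub_le_integral_plateauCutoff integral_plateauCutoff_le twinPrimeConst_le_one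
  half_le_twinPrimeConst)

namespace MMSmoothing

/-! ### The harmless factors: the correction factor and the singular series -/

/-- The Matomäki–Merikoski correction factor has modulus `≤ 1`: every prime factor of the odd part
`q' = q/2^r` is `≥ 3`, so each `|−1/(p − 2)| ≤ 1`. [cite: MatomakiMerikoski2023, Theorem 1.3] -/
theorem abs_corr_le_one (q h : ℕ) :
    |(if Nat.totient (2 ^ padicValNat 2 q) ∣ h then
        (-1 : ℝ) ^ (h / Nat.totient (2 ^ padicValNat 2 q)) *
          ∏ p ∈ (q / 2 ^ padicValNat 2 q).primeFactors.filter (fun p => ¬ p ∣ h),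
            (-1 : ℝ) / ((p : ℝ) - 2)
      else 0)| ≤ 1 := by
  split_ifs with hdiv
  · rw [abs_mul, abs_pow, abs_neg, abs_one, one_pow, one_mul, Finset.abs_prod]
    refine Finset.prod_le_one (fun p _ => abs_nonneg _) fun p hp => ?_
    have hpf := (Finset.mem_filter.mp hp).1
    have hpp : p.Prime := Nat.prime_of_mem_primeFactors hpf
    have hp2 : p ≠ 2 := by
      intro h2
      subst h2
      rcases Nat.eq_zero_or_pos q with hq | hq
      · subst hq; simp at hpf
      · have hnd : ¬ 2 ∣ q / 2 ^ padicValNat 2 q := by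
          rw [← Nat.factorization_def q Nat.prime_two]
          exact Nat.not_dvd_ordCompl Nat.prime_two hq.ne'
        exact hnd (Nat.dvd_of_mem_primeFactors hpf)
    have hp3 : (3 : ℝ) ≤ p := by exact_mod_cast lt_of_le_of_ne hpp.two_le (Ne.symm hp2)
    rw [abs_div, abs_neg, abs_one, abs_of_pos (by linarith), div_le_one (by linarith)]
    linarith
  · simp

/-- `∑_{n ∈ S} 1/(n(n − 2)) ≤ 3/4` for a finite set `S` of integers `≥ 3` (telescoping:
`∑_{3 ≤ n ≤ N} 1/(n(n−2)) = (3/2 − 1/(N−1) − 1/N)/2`). [folklore] -/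
theorem sum_inv_mul_sub_two_le {S : Finset ℕ} (hS : ∀ n ∈ S, 3 ≤ n) :
    ∑ n ∈ S, (1 : ℝ) / ((n : ℝ) * ((n : ℝ) - 2)) ≤ 3 / 4 := by
  -- `S ⊆ Icc 3 N`
  set N := S.sup id with hN
  have hsub : S ⊆ Icc 3 N := fun n hn => mem_Icc.mpr ⟨hS n hn, Finset.le_sup (f := id) hn⟩
  have htel : ∀ M : ℕ, ∑ n ∈ Icc 3 (M + 3), (1 : ℝ) / ((n : ℝ) * ((n : ℝ) - 2)) =
      (3 / 2 - 1 / ((M : ℝ) + 2) - 1 / ((M : ℝ) + 3)) / 2 := by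
    intro M
    induction M with
    | zero => norm_num [Finset.Icc_self]
    | succ M ih =>
      rw [show M + 1 + 3 = (M + 3) + 1 by ring, Finset.sum_Icc_succ_top (by omega), ih]
      have h1 : (M : ℝ) + 2 ≠ 0 := by positivity
      have h2 : (M : ℝ) + 3 ≠ 0 := by positivity
      have h3 : (M : ℝ) + 4 ≠ 0 := by positivity
      have h4 : ((M + 3 + 1 : ℕ) : ℝ) * (((M + 3 + 1 : ℕ) : ℝ) - 2) = ((M : ℝ) + 4) * ((M : ℝ) + 2) := by
        push_cast; ring
      have h5 : ((M + 1 : ℕ) : ℝ) = (M : ℝ) + 1 := by push_cast; ring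
      rw [h4, h5]
      field_simp
      ring
  calc ∑ n ∈ S, (1 : ℝ) / ((n : ℝ) * ((n : ℝ) - 2))
      ≤ ∑ n ∈ Icc 3 N, (1 : ℝ) / ((n : ℝ) * ((n : ℝ) - 2)) := by
        refine sum_le_sum_of_subset_of_nonneg hsub fun n hn _ => ?_
        have h3 : (3 : ℝ) ≤ n := by exact_mod_cast (mem_Icc.mp hn).1
        have : 0 < (n : ℝ) * ((n : ℝ) - 2) := by nlinarith
        positivity
    _ ≤ ∑ n ∈ Icc 3 (N + 3), (1 : ℝ) / ((n : ℝ) * ((n : ℝ) - 2)) := by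
        refine sum_le_sum_of_subset_of_nonneg (Icc_subset_Icc le_rfl (by omega)) fun n hn _ => ?_
        have h3 : (3 : ℝ) ≤ n := by exact_mod_cast (mem_Icc.mp hn).1
        have : 0 < (n : ℝ) * ((n : ℝ) - 2) := by nlinarith
        positivity
    _ = (3 / 2 - 1 / ((N : ℝ) + 2) - 1 / ((N : ℝ) + 3)) / 2 := htel N
    _ ≤ 3 / 4 := by
        have h1 : 0 < 1 / ((N : ℝ) + 2) := by positivity
        have h2 : 0 < 1 / ((N : ℝ) + 3) := by positivity
        linarith

/-- **`𝔖(h) ≤ 6 h/φ(h)`**: `𝔖(h) = 2C₂ ∏_{p ∣ h, p > 2} (p−1)/(p−2)` (even `h`; `0` for odd `h`),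
`(p−1)/(p−2) = (p/(p−1))(1 + 1/(p(p−2)))`, `∏ (1 + 1/(p(p−2))) ≤ e^{3/4} ≤ e ≤ 11/4`, `C₂ ≤ 1`,
and `∏_{p ∣ h, p > 2} p/(p−1) ≤ h/φ(h)`. [folklore] -/
theorem goldbachSingularSeries_le_mul_div_totient {h : ℕ} (hh : h ≠ 0) :
    goldbachSingularSeries h ≤ 6 * ((h : ℝ) / (Nat.totient h : ℝ)) := by
  have hφ : (0 : ℝ) < Nat.totient h := by exact_mod_cast Nat.totient_pos.mpr (Nat.pos_of_ne_zero hh)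
  have hquot : 1 ≤ (h : ℝ) / (Nat.totient h : ℝ) := by
    rw [le_div_iff₀ hφ, one_mul]; exact_mod_cast Nat.totient_le h
  unfold goldbachSingularSeries
  split_ifs with hodd
  · positivity
  · -- even `h`
    set P := h.primeFactors.filter (2 < ·) with hP
    have hC : twinPrimeConst ≤ 1 := twinPrimeConst_le_one
    have hC0 : 0 ≤ twinPrimeConst := le_trans (by norm_num) half_le_twinPrimeConst
    have hmem : ∀ p ∈ P, p.Prime ∧ (3 : ℝ) ≤ p ∧ p ∣ h := by
      intro p hp
      obtain ⟨hpf, h2⟩ := mem_filter.mp hp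
      exact ⟨Nat.prime_of_mem_primeFactors hpf, by exact_mod_cast h2, Nat.dvd_of_mem_primeFactors hpf⟩
    -- `(p-1)/(p-2) = (p/(p-1)) (1 + 1/(p(p-2)))`
    have hfac : ∏ p ∈ P, (((p : ℝ) - 1) / ((p : ℝ) - 2)) =
        (∏ p ∈ P, ((p : ℝ) / ((p : ℝ) - 1))) * ∏ p ∈ P, (1 + 1 / ((p : ℝ) * ((p : ℝ) - 2))) := by
      rw [← prod_mul_distrib]
      refine prod_congr rfl fun p hp => ?_
      have h3 := (hmem p hp).2.1
      have hp1 : (p : ℝ) - 1 ≠ 0 := by linarith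
      have hp2 : (p : ℝ) - 2 ≠ 0 := by linarith
      have hp0 : (p : ℝ) ≠ 0 := by linarith
      field_simp
      ring
    -- `∏ (1 + 1/(p(p-2))) ≤ exp(3/4) ≤ e ≤ 11/4`
    have hexp : ∏ p ∈ P, (1 + 1 / ((p : ℝ) * ((p : ℝ) - 2))) ≤ Real.exp (3 / 4) := by
      calc ∏ p ∈ P, (1 + 1 / ((p : ℝ) * ((p : ℝ) - 2)))
          ≤ ∏ p ∈ P, Real.exp (1 / ((p : ℝ) * ((p : ℝ) - 2))) := by
            refine prod_le_prod (fun p hp => ?_) fun p hp => ?_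
            · have h3 := (hmem p hp).2.1
              have : 0 < (p : ℝ) * ((p : ℝ) - 2) := by nlinarith
              positivity
            · linarith [Real.add_one_le_exp (1 / ((p : ℝ) * ((p : ℝ) - 2)))]
        _ = Real.exp (∑ p ∈ P, 1 / ((p : ℝ) * ((p : ℝ) - 2))) := by rw [Real.exp_sum]
        _ ≤ Real.exp (3 / 4) := Real.exp_le_exp.mpr (sum_inv_mul_sub_two_le fun p hp => by
            exact_mod_cast (hmem p hp).2.1)
    have hexp2 : Real.exp (3 / 4) ≤ 11 / 4 := by
      have := Real.exp_one_lt_d9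
      have h1 : Real.exp (3 / 4) ≤ Real.exp 1 := Real.exp_le_exp.mpr (by norm_num)
      linarith
    -- `∏_{p ∈ P} p/(p-1) ≤ h/φ(h)`
    have hquot2 : ∏ p ∈ P, ((p : ℝ) / ((p : ℝ) - 1)) ≤ (h : ℝ) / (Nat.totient h : ℝ) := by
      have hid := Nat.totient_mul_prod_primeFactors h
      have hidr : (Nat.totient h : ℝ) * ∏ p ∈ h.primeFactors, (p : ℝ) =
          (h : ℝ) * ∏ p ∈ h.primeFactors, ((p - 1 : ℕ) : ℝ) := by
        have e := congrArg (fun n : ℕ => (n : ℝ)) hid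
        push_cast at e
        exact e
      have hall : (h : ℝ) / (Nat.totient h : ℝ) = ∏ p ∈ h.primeFactors, ((p : ℝ) / ((p : ℝ) - 1)) := by
        have hP0 : 0 < ∏ p ∈ h.primeFactors, (((p - 1 : ℕ) : ℝ)) := by
          refine prod_pos fun p hp => ?_
          have := (Nat.prime_of_mem_primeFactors hp).two_le
          exact_mod_cast (show 0 < p - 1 by omega)
        rw [prod_div_distrib, div_eq_div_iff hφ.ne' (by
          refine (prod_pos fun p hp => ?_).ne'
          have h2 : (2 : ℝ) ≤ p := by exact_mod_cast (Nat.prime_of_mem_primeFactors hp).two_le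
          linarith)]
        have hcast : ∏ p ∈ h.primeFactors, ((p : ℝ) - 1) = ∏ p ∈ h.primeFactors, (((p - 1 : ℕ) : ℝ)) := by
          refine prod_congr rfl fun p hp => ?_
          have := (Nat.prime_of_mem_primeFactors hp).two_le
          rw [Nat.cast_sub (by omega)]; simp
        rw [hcast, ← hidr]
        ring
      rw [hall, ← Finset.prod_sdiff (filter_subset (2 < ·) h.primeFactors)]
      have hge1 : ∀ p ∈ h.primeFactors, (1 : ℝ) ≤ (p : ℝ) / ((p : ℝ) - 1) := by
        intro p hp
        have h2 : (2 : ℝ) ≤ p := by exact_mod_cast (Nat.prime_of_mem_primeFactors hp).two_le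
        rw [le_div_iff₀ (by linarith)]; linarith
      have hone : (1 : ℝ) ≤ ∏ p ∈ h.primeFactors \ P, ((p : ℝ) / ((p : ℝ) - 1)) :=
        calc (1 : ℝ) = ∏ _p ∈ h.primeFactors \ P, (1 : ℝ) := Finset.prod_const_one.symm
          _ ≤ ∏ p ∈ h.primeFactors \ P, ((p : ℝ) / ((p : ℝ) - 1)) :=
              Finset.prod_le_prod (fun _ _ => zero_le_one) fun p hp => hge1 p (Finset.mem_sdiff.mp hp).1
      have hP0' : 0 ≤ ∏ p ∈ P, ((p : ℝ) / ((p : ℝ) - 1)) := prod_nonneg fun p hp => by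
        have h3 := (hmem p hp).2.1; exact div_nonneg (by linarith) (by linarith)
      exact le_mul_of_one_le_left hP0' hone
    have hprod0 : 0 ≤ ∏ p ∈ P, ((p : ℝ) / ((p : ℝ) - 1)) := prod_nonneg fun p hp => by
      have h3 := (hmem p hp).2.1; exact div_nonneg (by linarith) (by linarith)
    rw [hfac]
    have h0 : 0 ≤ ∏ p ∈ P, (1 + 1 / ((p : ℝ) * ((p : ℝ) - 2))) := by
      refine prod_nonneg fun p hp => ?_
      have h3 := (hmem p hp).2.1
      have : 0 < (p : ℝ) * ((p : ℝ) - 2) := by nlinarith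
      positivity
    have hA : (∏ p ∈ P, ((p : ℝ) / ((p : ℝ) - 1))) * ∏ p ∈ P, (1 + 1 / ((p : ℝ) * ((p : ℝ) - 2))) ≤
        ((h : ℝ) / (Nat.totient h : ℝ)) * (11 / 4) :=
      mul_le_mul hquot2 (hexp.trans hexp2) h0 (by positivity)
    have hB : 0 ≤ (∏ p ∈ P, ((p : ℝ) / ((p : ℝ) - 1))) * ∏ p ∈ P, (1 + 1 / ((p : ℝ) * ((p : ℝ) - 2))) :=
      mul_nonneg hprod0 h0
    nlinarith

/-! ### Trivial bounds for `Λ(n)Λ(n + h)` -/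

/-- `0 ≤ Λ(n)Λ(n + h) ≤ log²(B)` whenever `n + h ≤ B` (`Λ ≤ log`). [folklore] -/
theorem vonMangoldt_mul_le_log_sq {n h : ℕ} {B : ℝ} (hB : (n : ℝ) + h ≤ B) (hn : 1 ≤ n) :
    Λ n * Λ (n + h) ≤ Real.log B ^ 2 := by
  have hn0 : (1 : ℝ) ≤ n := by exact_mod_cast hn
  have hB1 : 1 ≤ B := by have : (0 : ℝ) ≤ h := Nat.cast_nonneg h; linarith
  have h1 : Λ n ≤ Real.log B :=
    ArithmeticFunction.vonMangoldt_le_log.trans (Real.log_le_log (by linarith) (by linarith))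
  have h2 : Λ (n + h) ≤ Real.log B :=
    ArithmeticFunction.vonMangoldt_le_log.trans (Real.log_le_log (by positivity) (by exact_mod_cast hB))
  have hlog0 : 0 ≤ Real.log B := Real.log_nonneg hB1
  rw [sq]
  exact mul_le_mul h1 h2 ArithmeticFunction.vonMangoldt_nonneg hlog0

/-- `0 ≤ Λ(n)Λ(m)`. [folklore] -/
theorem vonMangoldt_mul_nonneg (n m : ℕ) : 0 ≤ Λ n * Λ m :=
  mul_nonneg ArithmeticFunction.vonMangoldt_nonneg ArithmeticFunction.vonMangoldt_nonneg

/-! ### The dyadic decomposition -/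

/-- `∑_{1 ≤ n ≤ X} a(n) = ∑_{1 ≤ n ≤ X/2^J} a(n) + ∑_{j < J} ∑_{X/2^{j+1} < n ≤ X/2^j} a(n)` for
real `X ≥ 0`. [folklore] -/
theorem sum_Icc_eq_sum_add_sum_dyadic (a : ℕ → ℝ) {X : ℝ} (hX : 0 ≤ X) (J : ℕ) :
    ∑ n ∈ Icc 1 ⌊X⌋₊, a n = ∑ n ∈ Icc 1 ⌊X / 2 ^ J⌋₊, a n +
      ∑ j ∈ Finset.range J, ∑ n ∈ Ioc ⌊X / 2 ^ (j + 1)⌋₊ ⌊X / 2 ^ j⌋₊, a n := by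
  induction J with
  | zero => simp
  | succ J ih =>
    rw [ih, Finset.sum_range_succ]
    have hle : ⌊X / 2 ^ (J + 1)⌋₊ ≤ ⌊X / 2 ^ J⌋₊ := by
      refine Nat.floor_mono ?_
      rw [pow_succ]
      exact div_le_div_of_nonneg_left hX (by positivity) (by linarith [pow_pos (two_pos (α := ℝ)) J])
    have hsplit : ∑ n ∈ Icc 1 ⌊X / 2 ^ J⌋₊, a n =
        ∑ n ∈ Icc 1 ⌊X / 2 ^ (J + 1)⌋₊, a n + ∑ n ∈ Ioc ⌊X / 2 ^ (J + 1)⌋₊ ⌊X / 2 ^ J⌋₊, a n := by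
      rw [show Icc 1 ⌊X / 2 ^ J⌋₊ = Ioc 0 ⌊X / 2 ^ J⌋₊ from rfl,
        show Icc 1 ⌊X / 2 ^ (J + 1)⌋₊ = Ioc 0 ⌊X / 2 ^ (J + 1)⌋₊ from rfl]
      exact (Finset.sum_Ioc_consecutive a (Nat.zero_le _) hle).symm
    rw [hsplit]
    ring

/-! ### Smoothing one dyadic block -/

/-- **The smoothing error on one block**: for `x ≥ 1`, `0 < δ ≤ 1/2`,
`g = plateauCutoff (1+δ) (2−δ) δ` and `0 ≤ a(n) ≤ M` on `1 ≤ n ≤ 2x`,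
`|∑_{x < n ≤ 2x} a(n) − ∑_{1 ≤ n ≤ 2x} g(n/x) a(n)| ≤ (2δx + 2) M`: the two weights agree except for
`n ∈ (x, (1+δ)x) ∪ ((2−δ)x, 2x]`, at most `2δx + 2` integers ("we replace the condition
`1_{n ∈ (x, 2x]}` by `g(n/x)` with an error term `O(δx log² X)`"). [cite: MatomakiMerikoski2023, §2] -/
theorem abs_sum_Ioc_sub_sum_smooth_le {a : ℕ → ℝ} {x δ M : ℝ} (hx : 1 ≤ x) (hδ : 0 < δ)
    (hδ2 : δ ≤ 1 / 2) (ha0 : ∀ n, 0 ≤ a n) (haM : ∀ n ∈ Icc 1 ⌊2 * x⌋₊, a n ≤ M) :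
    |(∑ n ∈ Ioc ⌊x⌋₊ ⌊2 * x⌋₊, a n) -
        ∑ n ∈ Icc 1 ⌊2 * x⌋₊, plateauCutoff (1 + δ) (2 - δ) δ (n / x) * a n| ≤
      (2 * δ * x + 2) * M := by
  have hx0 : 0 < x := by linarith
  have hab : 1 + δ ≤ 2 - δ := by linarith
  have hM0 : 0 ≤ M := by
    have h1 : 1 ∈ Icc 1 ⌊2 * x⌋₊ := mem_Icc.mpr ⟨le_rfl, Nat.le_floor (by push_cast; linarith)⟩
    exact (ha0 1).trans (haM 1 h1)
  set g : ℝ → ℝ := plateauCutoff (1 + δ) (2 - δ) δ with hg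
  have hg01 : ∀ u, 0 ≤ g u ∧ g u ≤ 1 := fun u => ⟨plateauCutoff_nonneg hδ hab u, plateauCutoff_le_one hδ hab u⟩
  -- write the sharp sum over `Icc 1 ⌊2x⌋` with the indicator of `(⌊x⌋, ⌊2x⌋]`
  have hsharp : ∑ n ∈ Ioc ⌊x⌋₊ ⌊2 * x⌋₊, a n =
      ∑ n ∈ Icc 1 ⌊2 * x⌋₊, (if ⌊x⌋₊ < n then a n else 0) := by
    rw [← sum_filter]
    congr 1
    ext n
    simp only [Finset.mem_Ioc, Finset.mem_filter, Finset.mem_Icc]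
    constructor
    · rintro ⟨h1, h2⟩; exact ⟨⟨by omega, h2⟩, h1⟩
    · rintro ⟨⟨_, h2⟩, h1⟩; exact ⟨h1, h2⟩
  rw [hsharp, ← sum_sub_distrib]
  -- the set where the two weights may differ
  set B : Finset ℕ := Ioc ⌊x⌋₊ ⌊(1 + δ) * x⌋₊ ∪ Ioc ⌊(2 - δ) * x⌋₊ ⌊2 * x⌋₊ with hB
  have hzero : ∀ n ∈ Icc 1 ⌊2 * x⌋₊, n ∉ B →
      (if ⌊x⌋₊ < n then a n else 0) - g (n / x) * a n = 0 := by
    intro n hn hnB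
    rw [hB, Finset.mem_union, Finset.mem_Ioc, Finset.mem_Ioc, not_or, not_and_or, not_and_or,
      not_lt, not_lt] at hnB
    obtain ⟨hn1, hn2⟩ := Finset.mem_Icc.mp hn
    have hn2' : (n : ℝ) ≤ 2 * x := by
      have := Nat.floor_le (show 0 ≤ 2 * x by linarith)
      exact le_trans (by exact_mod_cast hn2) this
    rcases hnB.1 with hle | hgt
    · -- `n ≤ ⌊x⌋`: both weights vanish
      rw [if_neg (not_lt.mpr hle)]
      have hnx : (n : ℝ) / x ≤ 1 := by
        rw [div_le_one hx0]
        exact le_trans (by exact_mod_cast hle) (Nat.floor_le hx0.le)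
      rw [hg, plateauCutoff_eq_zero_of_le hδ hab (by linarith)]
      ring
    · -- `n > ⌊(1+δ)x⌋`, so `n ≥ (1+δ)x > x`
      have hn3 : (1 + δ) * x < n := (Nat.floor_lt (by positivity)).mp (not_le.mp hgt)
      have hxn : ⌊x⌋₊ < n := (Nat.floor_lt hx0.le).mpr (by nlinarith)
      rw [if_pos hxn]
      rcases hnB.2 with hle2 | hgt2
      · -- `n ≤ ⌊(2-δ)x⌋`: inside the plateau
        have hn4 : (n : ℝ) ≤ (2 - δ) * x := le_trans (by exact_mod_cast hle2) (Nat.floor_le (by nlinarith))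
        rw [hg, plateauCutoff_eq_one hδ]
        · ring
        · rw [le_div_iff₀ hx0]; linarith
        · rw [div_le_iff₀ hx0]; linarith
      · -- `n > ⌊2x⌋`: impossible
        exact absurd hn2 hgt2
  rw [← Finset.sum_filter_of_ne (p := fun n => n ∈ B) (fun n hn hne => by
    by_contra hnB
    exact hne (hzero n hn hnB))]
  -- on `B` each term is at most `M` in absolute value
  have hterm : ∀ n ∈ (Icc 1 ⌊2 * x⌋₊).filter (fun n => n ∈ B),
      |(if ⌊x⌋₊ < n then a n else 0) - g (n / x) * a n| ≤ M := by
    intro n hn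
    have hnI := (mem_filter.mp hn).1
    have haM' := haM n hnI
    have ha0' := ha0 n
    obtain ⟨hg0, hg1⟩ := hg01 (n / x)
    rw [abs_le]
    split_ifs
    · constructor <;> nlinarith
    · constructor <;> nlinarith
  calc |∑ n ∈ (Icc 1 ⌊2 * x⌋₊).filter (fun n => n ∈ B), ((if ⌊x⌋₊ < n then a n else 0) - g (n / x) * a n)|
      ≤ ∑ n ∈ (Icc 1 ⌊2 * x⌋₊).filter (fun n => n ∈ B), |(if ⌊x⌋₊ < n then a n else 0) - g (n / x) * a n| :=
        abs_sum_le_sum_abs _ _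
    _ ≤ ∑ n ∈ (Icc 1 ⌊2 * x⌋₊).filter (fun n => n ∈ B), M := sum_le_sum hterm
    _ = (#((Icc 1 ⌊2 * x⌋₊).filter (fun n => n ∈ B)) : ℝ) * M := by rw [sum_const, nsmul_eq_mul]
    _ ≤ (#B : ℝ) * M := by
        refine mul_le_mul_of_nonneg_right ?_ hM0
        exact_mod_cast card_le_card (fun n hn => (mem_filter.mp hn).2)
    _ ≤ (2 * δ * x + 2) * M := by
        refine mul_le_mul_of_nonneg_right ?_ hM0
        have h1 := Literature.NumberTheory.Sieve.BFI.card_Ioc_floor_le hx0.le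
          (show x ≤ (1 + δ) * x by nlinarith)
        have h2 := Literature.NumberTheory.Sieve.BFI.card_Ioc_floor_le (show 0 ≤ (2 - δ) * x by nlinarith)
          (show (2 - δ) * x ≤ 2 * x by nlinarith)
        calc (#B : ℝ) ≤ (#(Ioc ⌊x⌋₊ ⌊(1 + δ) * x⌋₊) : ℝ) + #(Ioc ⌊(2 - δ) * x⌋₊ ⌊2 * x⌋₊) := by
              exact_mod_cast card_union_le _ _
          _ ≤ ((1 + δ) * x - x + 1) + (2 * x - (2 - δ) * x + 1) := add_le_add h1 h2
          _ = 2 * δ * x + 2 := by ring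

/-! ### Comparison of the error functions at the scales `x` and `X` -/

/-- **The error function of Theorem 1.3 at a dyadic scale**: if `0.89 log X ≤ log x ≤ log X`
(`log X > 0`), `η ≥ 10` and `C ≥ 0`, then with `V' = log x/log q`, `V = log X/log q` (`log q > 0`)
`exp(−2C√(V' log η)) + exp(−2C (log x)^{3/5−ε}) + V' log⁶η/η ≤ exp(−C√(V log η)) + exp(−C (log X)^{3/5−ε}) + V log⁶η/η`
("Hence now `q = X^{1/V'}` for some `V' ∈ [(1 − ε/2)V, V]`", §7). [cite: MatomakiMerikoski2023, §7] -/
theorem errorTerms_dyadic_le {C ε x X q η : ℝ} (hC : 0 ≤ C) (hε : 0 < ε) (hlogX : 0 < Real.log X)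
    (hlow : 0.89 * Real.log X ≤ Real.log x) (hup : Real.log x ≤ Real.log X) (hq : 0 < Real.log q)
    (hη : 10 ≤ η) :
    Real.exp (-(2 * C) * Real.sqrt (Real.log x / Real.log q * Real.log η)) +
        Real.exp (-(2 * C) * Real.log x ^ (3 / 5 - ε)) +
        Real.log x / Real.log q * Real.log η ^ (6 : ℕ) / η ≤
      Real.exp (-C * Real.sqrt (Real.log X / Real.log q * Real.log η)) +
        Real.exp (-C * Real.log X ^ (3 / 5 - ε)) +
        Real.log X / Real.log q * Real.log η ^ (6 : ℕ) / η := by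
  have hη0 : 0 < η := by linarith
  have hlogη : 0 < Real.log η := Real.log_pos (by linarith)
  have hlogx : 0 < Real.log x := by linarith
  have hV' : 0 ≤ Real.log x / Real.log q := by positivity
  -- term 1: `2√(V' log η) ≥ √(V log η)` since `4V' ≥ V`
  have h1 : Real.exp (-(2 * C) * Real.sqrt (Real.log x / Real.log q * Real.log η)) ≤
      Real.exp (-C * Real.sqrt (Real.log X / Real.log q * Real.log η)) := by
    refine Real.exp_le_exp.mpr ?_
    have hsq : Real.sqrt (Real.log X / Real.log q * Real.log η) ≤
        2 * Real.sqrt (Real.log x / Real.log q * Real.log η) := by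
      rw [show (2 : ℝ) = Real.sqrt 4 by rw [show (4 : ℝ) = 2 ^ 2 by norm_num, Real.sqrt_sq (by norm_num)],
        ← Real.sqrt_mul (by norm_num)]
      refine Real.sqrt_le_sqrt ?_
      have : Real.log X / Real.log q ≤ 4 * (Real.log x / Real.log q) := by
        rw [← mul_div_assoc]; exact div_le_div_of_nonneg_right (by linarith) hq.le
      nlinarith [hlogη.le]
    nlinarith [Real.sqrt_nonneg (Real.log x / Real.log q * Real.log η)]
  -- term 2: `2 (log x)^a ≥ (log X)^a`
  have h2 : Real.exp (-(2 * C) * Real.log x ^ (3 / 5 - ε)) ≤ Real.exp (-C * Real.log X ^ (3 / 5 - ε)) := by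
    refine Real.exp_le_exp.mpr ?_
    have hpow : Real.log X ^ (3 / 5 - ε) ≤ 2 * Real.log x ^ (3 / 5 - ε) := by
      rcases le_or_gt 0 (3 / 5 - ε) with ha | ha
      · -- nonnegative exponent: `(log x)^a ≥ (0.89 log X)^a ≥ 0.89 (log X)^a`
        have ha1 : 3 / 5 - ε ≤ 1 := by linarith
        have hb : (0.89 * Real.log X) ^ (3 / 5 - ε) ≤ Real.log x ^ (3 / 5 - ε) :=
          Real.rpow_le_rpow (by positivity) hlow ha
        have hc : (0.89 : ℝ) ^ (3 / 5 - ε) * Real.log X ^ (3 / 5 - ε) = (0.89 * Real.log X) ^ (3 / 5 - ε) :=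
          (Real.mul_rpow (by norm_num) hlogX.le).symm
        have hd : (0.89 : ℝ) ≤ 0.89 ^ (3 / 5 - ε) := by
          conv_lhs => rw [← Real.rpow_one 0.89]
          exact Real.rpow_le_rpow_of_exponent_ge (by norm_num) (by norm_num) ha1
        have he : 0 ≤ Real.log X ^ (3 / 5 - ε) := Real.rpow_nonneg hlogX.le _
        nlinarith
      · -- negative exponent: `(log x)^a ≥ (log X)^a`
        have hb : Real.log X ^ (3 / 5 - ε) ≤ Real.log x ^ (3 / 5 - ε) :=
          Real.rpow_le_rpow_of_nonpos hlogx hup ha.le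
        have he : 0 ≤ Real.log x ^ (3 / 5 - ε) := Real.rpow_nonneg hlogx.le _
        linarith
    nlinarith [Real.rpow_nonneg hlogx.le (3 / 5 - ε)]
  -- term 3
  have h3 : Real.log x / Real.log q * Real.log η ^ (6 : ℕ) / η ≤
      Real.log X / Real.log q * Real.log η ^ (6 : ℕ) / η := by
    have : Real.log x / Real.log q ≤ Real.log X / Real.log q := div_le_div_of_nonneg_right hup hq.le
    have h6 : 0 ≤ Real.log η ^ (6 : ℕ) / η := by positivity
    calc Real.log x / Real.log q * Real.log η ^ (6 : ℕ) / η
        = Real.log x / Real.log q * (Real.log η ^ (6 : ℕ) / η) := by ring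
      _ ≤ Real.log X / Real.log q * (Real.log η ^ (6 : ℕ) / η) := mul_le_mul_of_nonneg_right this h6
      _ = Real.log X / Real.log q * Real.log η ^ (6 : ℕ) / η := by ring
  linarith

/-! ### Absorbing power savings into `exp(−C (log X)^{3/5−ε})` -/

/-- **`X^{−1/1000} ≤ K exp(−C (log X)^{3/5−ε})`** for all `X ≥ 3`, with `K = K(C, ε)` (`ε > 0`):
the power saving beats the sub-logarithmic one ((log X)^{a} with `a = 3/5 − ε < 1`:
`C t^a ≤ κt + C(C/κ)^{a/(1−a)}` for `t ≥ 1`, `κ = 1/1000`). [folklore] -/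
theorem exists_rpow_neg_le_mul_exp (C : ℝ) {ε : ℝ} (hε : 0 < ε) :
    ∃ K : ℝ, 0 < K ∧ ∀ X : ℝ, 3 ≤ X →
      X ^ (-(1 / 1000 : ℝ)) ≤ K * Real.exp (-C * Real.log X ^ (3 / 5 - ε)) := by
  set a : ℝ := 3 / 5 - ε with ha
  set κ : ℝ := 1 / 1000 with hκ
  have hκ0 : 0 < κ := by norm_num [hκ]
  have ha1 : a < 1 := by rw [ha]; linarith
  rcases le_or_gt C 0 with hC | hC
  · -- `C ≤ 0`: the exponential is `≥ 1 ≥ X^{-κ}`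
    refine ⟨1, one_pos, fun X hX => ?_⟩
    have hX1 : 1 ≤ X := by linarith
    have ht : 0 ≤ Real.log X ^ a := Real.rpow_nonneg (Real.log_nonneg hX1) a
    have h1 : X ^ (-(1 / 1000 : ℝ)) ≤ 1 := Real.rpow_le_one_of_one_le_of_nonpos hX1 (by norm_num)
    have h2 : 1 ≤ Real.exp (-C * Real.log X ^ a) := Real.one_le_exp (by nlinarith)
    linarith
  · rcases le_or_gt a 0 with ha0 | ha0
    · -- `a ≤ 0`: `(log X)^a ≤ 1`, so the exponential is `≥ e^{-C}`
      refine ⟨Real.exp C, Real.exp_pos C, fun X hX => ?_⟩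
      have hX1 : 1 ≤ X := by linarith
      have hlog1 : 1 ≤ Real.log X := by
        rw [← Real.log_exp 1]
        refine Real.log_le_log (Real.exp_pos 1) (le_trans ?_ hX)
        linarith [Real.exp_one_lt_d9]
      have ht : Real.log X ^ a ≤ 1 := Real.rpow_le_one_of_one_le_of_nonpos hlog1 ha0
      have h1 : X ^ (-(1 / 1000 : ℝ)) ≤ 1 := Real.rpow_le_one_of_one_le_of_nonpos hX1 (by norm_num)
      have h2 : Real.exp (-C) ≤ Real.exp (-C * Real.log X ^ a) := Real.exp_le_exp.mpr (by nlinarith)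
      have h3 : Real.exp C * Real.exp (-C) = 1 := by rw [← Real.exp_add]; simp
      nlinarith [Real.exp_pos C, Real.exp_pos (-C)]
    · -- `0 < a < 1`
      set D : ℝ := C * (C / κ) ^ (a / (1 - a)) with hD
      refine ⟨Real.exp D, Real.exp_pos D, fun X hX => ?_⟩
      have hX0 : 0 < X := by linarith
      have hX1 : 1 ≤ X := by linarith
      have hlog1 : 1 ≤ Real.log X := by
        rw [← Real.log_exp 1]
        refine Real.log_le_log (Real.exp_pos 1) (le_trans ?_ hX)
        linarith [Real.exp_one_lt_d9]
      set t : ℝ := Real.log X with ht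
      have ht0 : 0 < t := by linarith
      -- key: `C t^a ≤ κ t + D`
      have hkey : C * t ^ a ≤ κ * t + D := by
        rcases le_or_gt (C / κ) (t ^ (1 - a)) with hcase | hcase
        · -- `t^{1-a} ≥ C/κ`: `C t^a = C t / t^{1-a} ≤ κ t`
          have h1a : 0 < t ^ (1 - a) := Real.rpow_pos_of_pos ht0 _
          have hta : t ^ a = t / t ^ (1 - a) := by
            rw [eq_div_iff h1a.ne', ← Real.rpow_add ht0]; simp
          rw [hta]
          have : C * (t / t ^ (1 - a)) ≤ κ * t := by
            rw [mul_div_assoc', div_le_iff₀ h1a]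
            have := mul_le_mul_of_nonneg_left hcase (show 0 ≤ κ * t by positivity)
            calc C * t = κ * t * (C / κ) := by field_simp
              _ ≤ κ * t * t ^ (1 - a) := this
          have hD0 : 0 ≤ D := by positivity
          linarith
        · -- `t^{1-a} < C/κ`: `t < (C/κ)^{1/(1-a)}` and `t^a < (C/κ)^{a/(1-a)}`
          have h1a0 : 0 < 1 - a := by linarith
          have htlt : t < (C / κ) ^ (1 / (1 - a)) := by
            have := Real.rpow_lt_rpow (Real.rpow_nonneg ht0.le _) hcase (one_div_pos.mpr h1a0)
            rwa [← Real.rpow_mul ht0.le, mul_one_div_cancel h1a0.ne', Real.rpow_one] at this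
          have hta : t ^ a ≤ (C / κ) ^ (a / (1 - a)) := by
            have := Real.rpow_le_rpow ht0.le htlt.le ha0.le
            rwa [← Real.rpow_mul (by positivity), show 1 / (1 - a) * a = a / (1 - a) by ring] at this
          have : C * t ^ a ≤ D := by rw [hD]; exact mul_le_mul_of_nonneg_left hta hC.le
          nlinarith
      -- conclude: `X^{-κ} = exp(-κ t) ≤ exp(D - C t^a) = e^D exp(-C t^a)`
      have hXκ : X ^ (-(1 / 1000 : ℝ)) = Real.exp (-κ * t) := by
        rw [Real.rpow_def_of_pos hX0, ht, hκ]; ring_nf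
      rw [hXκ, ← Real.exp_add]
      exact Real.exp_le_exp.mpr (by linarith)

/-- `(log Y)³ ≤ 2000³ Y^{3/2000}` for `Y ≥ 1` (`log Y ≤ Y^s/s`). [folklore] -/
theorem log_pow_three_le {Y : ℝ} (hY : 1 ≤ Y) : Real.log Y ^ 3 ≤ 2000 ^ 3 * Y ^ (3 / 2000 : ℝ) := by
  have h1 : Real.log Y ≤ Y ^ (1 / 2000 : ℝ) / (1 / 2000) := Real.log_le_rpow_div (by linarith) (by norm_num)
  have h2 : Real.log Y ≤ 2000 * Y ^ (1 / 2000 : ℝ) := by linarith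
  have h0 : 0 ≤ Real.log Y := Real.log_nonneg hY
  calc Real.log Y ^ 3 ≤ (2000 * Y ^ (1 / 2000 : ℝ)) ^ 3 := pow_le_pow_left₀ h0 h2 3
    _ = 2000 ^ 3 * (Y ^ (1 / 2000 : ℝ)) ^ (3 : ℕ) := by ring
    _ = 2000 ^ 3 * Y ^ (3 / 2000 : ℝ) := by
        rw [← Real.rpow_natCast (Y ^ (1 / 2000 : ℝ)) 3, ← Real.rpow_mul (by linarith)]
        norm_num

/-- `∑_{j < J} X/2^{j+1} = X − X/2^J`. [folklore] -/
theorem sum_dyadic_scales (X : ℝ) (J : ℕ) :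
    ∑ j ∈ Finset.range J, X / 2 ^ (j + 1) = X - X / 2 ^ J := by
  induction J with
  | zero => simp
  | succ J ih =>
    rw [Finset.sum_range_succ, ih, pow_succ]
    have h2 : (2 : ℝ) ^ J ≠ 0 := pow_ne_zero J two_ne_zero
    field_simp
    ring

/-- The bookkeeping of the polynomially small errors of the reduction:
`P L² + (Q + 2J) L² + 12φ(Q + P) ≤ 30 φ L³ P` when `1 ≤ P`, `Q ≤ P`, `1 ≤ L`, `1 ≤ φ`,
`J ≤ 2L`. [folklore] -/
theorem poly_errors_le {P Q L φ Jr : ℝ} (hP : 1 ≤ P) (hQP : Q ≤ P) (hL : 1 ≤ L)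
    (hφ : 1 ≤ φ) (hJ : Jr ≤ 2 * L) :
    P * L ^ 2 + (Q + 2 * Jr) * L ^ 2 + 12 * φ * (Q + P) ≤ 30 * φ * L ^ 3 * P := by
  have hL0 : 0 ≤ L := by linarith
  have hP0 : 0 ≤ P := by linarith
  have hL2 : L ^ 2 ≤ L ^ 3 := by nlinarith
  have hL3 : 1 ≤ L ^ 3 := one_le_pow₀ hL
  have hPL : 0 ≤ P * L ^ 3 := by positivity
  -- `P L² ≤ φ P L³`
  have h1 : P * L ^ 2 ≤ φ * (P * L ^ 3) := by
    have : P * L ^ 2 ≤ P * L ^ 3 := mul_le_mul_of_nonneg_left hL2 hP0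
    nlinarith
  -- `(Q + 2J) L² ≤ (P + 4L) L² ≤ P L³ + 4 L³ ≤ 5 P L³ ≤ 5 φ P L³`
  have h2 : (Q + 2 * Jr) * L ^ 2 ≤ 5 * (φ * (P * L ^ 3)) := by
    have e1 : (Q + 2 * Jr) * L ^ 2 ≤ (P + 4 * L) * L ^ 2 :=
      mul_le_mul_of_nonneg_right (by linarith) (by positivity)
    have e2 : (P + 4 * L) * L ^ 2 = P * L ^ 2 + 4 * L ^ 3 := by ring
    have e3 : 4 * L ^ 3 ≤ 4 * (P * L ^ 3) := by nlinarith
    have e4 : P * L ^ 2 ≤ P * L ^ 3 := mul_le_mul_of_nonneg_left hL2 hP0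
    have e5 : P * L ^ 3 ≤ φ * (P * L ^ 3) := le_mul_of_one_le_left hPL hφ
    nlinarith
  -- `12 φ (Q + P) ≤ 24 φ P ≤ 24 φ P L³`
  have h3 : 12 * φ * (Q + P) ≤ 24 * (φ * (P * L ^ 3)) := by
    have e1 : Q + P ≤ 2 * P := by linarith
    have e2 : P ≤ P * L ^ 3 := le_mul_of_one_le_right hP0 hL3
    have hφ0 : 0 ≤ φ := by linarith
    nlinarith [mul_le_mul_of_nonneg_left e1 hφ0, mul_le_mul_of_nonneg_left e2 hφ0]
  nlinarith

end MMSmoothing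

open MMSmoothing

/-! ### The reduction -/

set_option maxHeartbeats 800000 in
/-- **Matomäki–Merikoski 2023, Theorem 1.3 from its smoothed dyadic form (§2).** Suppose that for
every `C ≥ 1`, `ε > 0`, `A > 0` there is `K` such that for every primitive quadratic `χ` mod
`q ≥ 2` with `L(1 − 1/(η log q), χ) = 0`, `η ≥ 10`, every real `x ≥ q^8`, every
`x^{−1/50}/4 ≤ δ ≤ 1/2` and every `1 ≤ h ≤ A x^{1+1/100}`,
`|∑_n g(n/x)Λ(n)Λ(n+h) − x (∫ g) 𝔖_h (1 + corr)| ≤ K (h/φ(h)) x (exp(−C√(V' log η)) + exp(−C (log x)^{3/5−ε}) + V' log⁶η/η)`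
with `g = plateauCutoff (1 + δ) (2 − δ) δ` (smooth, `= 1` on `[1+δ, 2−δ]`, `= 0` off `(1, 2)`,
`|g^{(j)}| ≤ 2K_j δ^{−j}`), `V' = log x/log q`, and `corr` the correction factor of Theorem 1.3
("Thus it suffices to show that `∑_n g(n/X)Λ(n)Λ(n+h) = ∫ g(y/X)dy · 𝔖_h(1 + …) + O_{C,ε}(…)`
whenever `0 < h ≤ X^{1+ε/2}`"). Then `MatomakiMerikoski2023_pairCorrelation` holds. Proof as in
§2: `δ = X^{−1/100}/2`, dyadic blocks `(X/2^{j+1}, X/2^j]`, `j < J`, `2^J ≍ X^{1/400}`, the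
initial segment `n ≤ X/2^J ≤ X^{1−1/400}` and the smoothing cost `(2δx + 2) log²((3+A)X)` per block
bounded trivially (`Λ ≤ log`), the hypothesis at each block with `(C, A) ↦ (2C, 3A)`
(`errorTerms_dyadic_le`), `∑_j x_j ∫g = X + O(δX + X/2^J)` against `𝔖_h ≤ 6h/φ(h)`, `|corr| ≤ 1`,
and all power savings absorbed by `X^{−1/1000} ≪ exp(−C(log X)^{3/5−ε})`
(`exists_rpow_neg_le_mul_exp`). [cite: MatomakiMerikoski2023, §2] -/
theorem MatomakiMerikoski2023_pairCorrelation_of_smoothed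
    (H : ∀ C : ℝ, 1 ≤ C → ∀ ε : ℝ, 0 < ε → ∀ A : ℝ, 0 < A → ∃ K : ℝ, 0 < K ∧
      ∀ (q : ℕ) [NeZero q], 2 ≤ q → ∀ χ : DirichletCharacter ℂ q, χ.IsPrimitive → χ.IsQuadratic →
        ∀ η : ℝ, 10 ≤ η → χ.LFunction ((1 - 1 / (η * Real.log q) : ℝ) : ℂ) = 0 →
          ∀ x : ℝ, (q : ℝ) ^ (8 : ℝ) ≤ x → ∀ δ : ℝ, x ^ (-(1 / 50 : ℝ)) / 4 ≤ δ → δ ≤ 1 / 2 →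
            ∀ h : ℕ, 1 ≤ h → (h : ℝ) ≤ A * x ^ (1 + 1 / 100 : ℝ) →
              |(∑ n ∈ Icc 1 ⌊2 * x⌋₊,
                  plateauCutoff (1 + δ) (2 - δ) δ (n / x) * (Λ n * Λ (n + h))) -
                  x * (∫ u, plateauCutoff (1 + δ) (2 - δ) δ u) * goldbachSingularSeries h *
                    (1 + if Nat.totient (2 ^ padicValNat 2 q) ∣ h then
                          (-1 : ℝ) ^ (h / Nat.totient (2 ^ padicValNat 2 q)) *
                            ∏ p ∈ (q / 2 ^ padicValNat 2 q).primeFactors.filter (fun p => ¬ p ∣ h),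
                              (-1 : ℝ) / ((p : ℝ) - 2)
                        else 0)| ≤
                K * ((h : ℝ) / (Nat.totient h : ℝ)) * x *
                  (Real.exp (-C * Real.sqrt (Real.log x / Real.log q * Real.log η)) +
                    Real.exp (-C * Real.log x ^ (3 / 5 - ε)) +
                    Real.log x / Real.log q * Real.log η ^ (6 : ℕ) / η)) :
    MatomakiMerikoski2023_pairCorrelation := by
  intro C hC ε hε A hA
  obtain ⟨K', hK', H'⟩ := H (2 * C) (by linarith) ε hε (3 * A) (by positivity)
  obtain ⟨Kabs, hKabs, Habs⟩ := exists_rpow_neg_le_mul_exp C hε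
  set KA : ℝ := 30 * 2000 ^ 3 * (3 + A) with hKA
  have hKA0 : 0 < KA := by positivity
  refine ⟨K' + KA * Kabs, by positivity, ?_⟩
  intro q _ hq χ hprim hquad η hη hL V X hV hX h hh hhA
  -- the correction factor and the singular series
  set corr : ℝ := (if Nat.totient (2 ^ padicValNat 2 q) ∣ h then
      (-1 : ℝ) ^ (h / Nat.totient (2 ^ padicValNat 2 q)) *
        ∏ p ∈ (q / 2 ^ padicValNat 2 q).primeFactors.filter (fun p => ¬ p ∣ h),
          (-1 : ℝ) / ((p : ℝ) - 2)
      else 0) with hcorr_def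
  have hcorr : |corr| ≤ 1 := abs_corr_le_one q h
  have hcorr1 : |1 + corr| ≤ 2 := by
    have := abs_add_le (1 : ℝ) corr; rw [abs_one] at this; linarith
  set hφ : ℝ := (h : ℝ) / (Nat.totient h : ℝ) with hhφ
  have hh0 : h ≠ 0 := by omega
  have hφpos : (0 : ℝ) < Nat.totient h := by exact_mod_cast Nat.totient_pos.mpr (by omega)
  have hhφ1 : 1 ≤ hφ := by rw [hhφ, le_div_iff₀ hφpos, one_mul]; exact_mod_cast Nat.totient_le h
  set 𝔖 : ℝ := goldbachSingularSeries h with h𝔖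
  have h𝔖0 : 0 ≤ 𝔖 := Literature.NumberTheory.Sieve.SingularSeriesMean.goldbachSingularSeries_nonneg h
  have h𝔖le : 𝔖 ≤ 6 * hφ := goldbachSingularSeries_le_mul_div_totient hh0
  -- basic sizes
  have hq2 : (2 : ℝ) ≤ q := by exact_mod_cast hq
  have hq0 : (0 : ℝ) < q := by linarith
  have hq1 : (1 : ℝ) ≤ q := by linarith
  have hlogq : 0 < Real.log q := Real.log_pos (by linarith)
  have hlog2 : Real.log 2 ≤ Real.log q := Real.log_le_log two_pos hq2
  have hlog2pos : 0 < Real.log 2 := Real.log_pos one_lt_two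
  have hV0 : 0 < V := by linarith
  have hX0 : 0 < X := by rw [hX]; exact Real.rpow_pos_of_pos hq0 V
  have hlogX : Real.log X = V * Real.log q := by rw [hX, Real.log_rpow hq0]
  have hlogXge : 10 * Real.log 2 ≤ Real.log X := by
    rw [hlogX]; exact mul_le_mul hV hlog2 hlog2pos.le (by linarith)
  have hlogX0 : 0 < Real.log X := by linarith only [hlogXge, hlog2pos]
  have hlog2d : (0.6931471803 : ℝ) < Real.log 2 := Real.log_two_gt_d9
  have hX1024 : (1024 : ℝ) ≤ X := by
    have h1 : Real.log 1024 = 10 * Real.log 2 := by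
      rw [show (1024 : ℝ) = 2 ^ 10 by norm_num, Real.log_pow]; norm_num
    have h2 : Real.log 1024 ≤ Real.log X := by rw [h1]; exact hlogXge
    exact (Real.log_le_log_iff (by norm_num) hX0).mp h2
  have hX3 : (3 : ℝ) ≤ X := by linarith
  have hX1 : (1 : ℝ) ≤ X := by linarith
  have hVeq : V = Real.log X / Real.log q := by rw [hlogX]; field_simp
  -- the summand and its trivial bound
  set a : ℕ → ℝ := fun n => Λ n * Λ (n + h) with ha_def
  have ha0 : ∀ n, 0 ≤ a n := fun n => vonMangoldt_mul_nonneg n (n + h)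
  set L : ℝ := Real.log ((3 + A) * X) with hL_def
  have h3AX : 3 ≤ (3 + A) * X := by
    have e : (3 + A) * X = 3 * X + A * X := by ring
    have hAX : 0 ≤ A * X := by positivity
    rw [e]; linarith only [hX1, hAX]
  have hL1 : 1 ≤ L := by
    rw [hL_def, ← Real.log_exp 1]
    refine Real.log_le_log (Real.exp_pos 1) (le_trans ?_ h3AX)
    linarith [Real.exp_one_lt_d9]
  have hL0 : 0 < L := by linarith
  have haL : ∀ n : ℕ, 1 ≤ n → (n : ℝ) ≤ 2 * X → a n ≤ L ^ 2 := by
    intro n hn1 hn2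
    refine vonMangoldt_mul_le_log_sq ?_ hn1
    have e : (3 + A) * X = 2 * X + A * X + X := by ring
    rw [e]
    linarith only [hn2, hhA, hX0]
  -- the parameters `δ` and `J`
  set δ : ℝ := X ^ (-(1 / 100 : ℝ)) / 2 with hδ_def
  have hXpow : X ^ (-(1 / 100 : ℝ)) ≤ 1 := Real.rpow_le_one_of_one_le_of_nonpos hX1 (by norm_num)
  have hXpow0 : 0 < X ^ (-(1 / 100 : ℝ)) := Real.rpow_pos_of_pos hX0 _
  have hδ0 : 0 < δ := by positivity
  have hδhalf : δ ≤ 1 / 2 := by rw [hδ_def]; linarith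
  have hδX : 2 * δ * X = X ^ (99 / 100 : ℝ) := by
    rw [hδ_def, show (99 / 100 : ℝ) = -(1 / 100) + 1 by norm_num, Real.rpow_add hX0, Real.rpow_one]
    ring
  set t : ℝ := Real.log X / (400 * Real.log 2) with ht_def
  have ht0 : 0 ≤ t := by positivity
  set J : ℕ := ⌊t⌋₊ + 1 with hJ_def
  have h2t : (2 : ℝ) ^ t = X ^ (1 / 400 : ℝ) := by
    rw [Real.rpow_def_of_pos two_pos, Real.rpow_def_of_pos hX0, ht_def]
    congr 1; field_simp
  have h2J_gt : X ^ (1 / 400 : ℝ) < (2 : ℝ) ^ J := by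
    rw [← h2t, ← Real.rpow_natCast 2 J]
    refine Real.rpow_lt_rpow_of_exponent_lt one_lt_two ?_
    rw [hJ_def]; push_cast; exact Nat.lt_floor_add_one t
  have h2J_le : (2 : ℝ) ^ J ≤ 2 * X ^ (1 / 400 : ℝ) := by
    rw [← h2t, hJ_def, pow_succ, mul_comm, ← Real.rpow_natCast 2 ⌊t⌋₊]
    exact mul_le_mul_of_nonneg_left (Real.rpow_le_rpow_of_exponent_le one_le_two (Nat.floor_le ht0)) two_pos.le
  have h2J_pos : (0 : ℝ) < 2 ^ J := pow_pos two_pos J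
  have hXJ : X / 2 ^ J < X ^ (399 / 400 : ℝ) := by
    rw [div_lt_iff₀ h2J_pos]
    calc X = X ^ (399 / 400 : ℝ) * X ^ (1 / 400 : ℝ) := by
          rw [← Real.rpow_add hX0, show (399 / 400 : ℝ) + 1 / 400 = 1 by norm_num, Real.rpow_one]
      _ < X ^ (399 / 400 : ℝ) * 2 ^ J := mul_lt_mul_of_pos_left h2J_gt (Real.rpow_pos_of_pos hX0 _)
  have hJL : (J : ℝ) ≤ 2 * L := by
    have h1 : (J : ℝ) ≤ t + 1 := by
      rw [hJ_def]; push_cast; linarith [Nat.floor_le ht0]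
    have h2 : t ≤ Real.log X := by
      rw [ht_def, div_le_iff₀ (by positivity)]
      have h400 : (1 : ℝ) ≤ 400 * Real.log 2 := by linarith
      exact le_mul_of_one_le_right hlogX0.le h400
    have h3 : Real.log X ≤ L := by
      rw [hL_def]; refine Real.log_le_log hX0 ?_
      have e : (3 + A) * X = X + (2 + A) * X := by ring
      have hAX : 0 ≤ (2 + A) * X := by positivity
      rw [e]; linarith only [hAX]
    linarith only [h1, h2, h3, hL1]
  -- the common error function
  set E : ℝ := Real.exp (-C * Real.sqrt (V * Real.log η)) + Real.exp (-C * Real.log X ^ (3 / 5 - ε)) +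
    V * Real.log η ^ (6 : ℕ) / η with hE_def
  have hη0 : 0 < η := by linarith
  have hE0 : 0 ≤ E := by positivity
  have hEexp : Real.exp (-C * Real.log X ^ (3 / 5 - ε)) ≤ E := by
    rw [hE_def]
    have : 0 ≤ V * Real.log η ^ (6 : ℕ) / η := by
      have := Real.log_nonneg (show (1:ℝ) ≤ η by linarith); positivity
    linarith [Real.exp_pos (-C * Real.sqrt (V * Real.log η))]
  -- the weight and its integral
  set g : ℝ → ℝ := plateauCutoff (1 + δ) (2 - δ) δ with hg_def
  have hab : 1 + δ ≤ 2 - δ := by linarith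
  set I : ℝ := ∫ u, g u with hI_def
  have hI1 : I ≤ 1 := by
    have := integral_plateauCutoff_le hδ0 hab; rw [← hg_def] at this; linarith
  have hI2 : 1 - 2 * δ ≤ I := by
    have := sub_le_integral_plateauCutoff hδ0 hab; rw [← hg_def] at this; linarith
  have hI0 : 0 ≤ I := by linarith
  -- the blocks
  have hblock : ∀ j ∈ Finset.range J,
      |(∑ n ∈ Ioc ⌊X / 2 ^ (j + 1)⌋₊ ⌊X / 2 ^ j⌋₊, a n) -
          X / 2 ^ (j + 1) * I * 𝔖 * (1 + corr)| ≤
        (2 * δ * (X / 2 ^ (j + 1)) + 2) * L ^ 2 + K' * hφ * (X / 2 ^ (j + 1)) * E := by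
    intro j hj
    have hjJ : j + 1 ≤ J := Finset.mem_range.mp hj
    set x : ℝ := X / 2 ^ (j + 1) with hx_def
    have h2j : (0 : ℝ) < 2 ^ (j + 1) := pow_pos two_pos _
    have hx2 : 2 * x = X / 2 ^ j := by rw [hx_def, pow_succ]; field_simp
    have hxX : x ≤ X / 2 := by
      rw [hx_def, div_le_div_iff_of_pos_left hX0 h2j two_pos]
      calc (2 : ℝ) = 2 ^ 1 := by norm_num
        _ ≤ 2 ^ (j + 1) := pow_le_pow_right₀ one_le_two (by omega)
    have hxlow : X ^ (399 / 400 : ℝ) / 2 ≤ x := by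
      -- `x = X/2^{j+1} ≥ X/2^J ≥ X^{399/400}/2`
      have h1 : X / 2 ^ J ≤ x := by
        rw [hx_def]
        exact div_le_div_of_nonneg_left hX0.le h2j (pow_le_pow_right₀ one_le_two hjJ)
      have h2 : X ^ (399 / 400 : ℝ) / 2 ≤ X / 2 ^ J := by
        rw [div_le_div_iff₀ two_pos h2J_pos]
        calc X ^ (399 / 400 : ℝ) * 2 ^ J ≤ X ^ (399 / 400 : ℝ) * (2 * X ^ (1 / 400 : ℝ)) :=
              mul_le_mul_of_nonneg_left h2J_le (Real.rpow_nonneg hX0.le _)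
          _ = X * 2 := by
              rw [mul_comm (2 : ℝ), ← mul_assoc, ← Real.rpow_add hX0,
                show (399 / 400 : ℝ) + 1 / 400 = 1 by norm_num, Real.rpow_one]
      exact h2.trans h1
    have hX399 : 0 < X ^ (399 / 400 : ℝ) := Real.rpow_pos_of_pos hX0 _
    have hx0 : 0 < x := by linarith
    have hx1 : 1 ≤ x := by
      -- `X^{399/400} ≥ 1024^{399/400} ≥ 2`
      have : (2 : ℝ) ≤ X ^ (399 / 400 : ℝ) := by
        calc (2 : ℝ) ≤ 1024 ^ (399 / 400 : ℝ) := by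
              have : (2 : ℝ) = 1024 ^ (1 / 10 : ℝ) := by
                rw [show (1024 : ℝ) = 2 ^ (10 : ℝ) by norm_num, ← Real.rpow_mul (by norm_num)]; norm_num
              rw [this]
              exact Real.rpow_le_rpow_of_exponent_le (by norm_num) (by norm_num)
          _ ≤ X ^ (399 / 400 : ℝ) := Real.rpow_le_rpow (by norm_num) hX1024 (by norm_num)
      linarith only [this, hxlow]
    -- (x2) `q^8 ≤ x`
    have hq8 : (q : ℝ) ^ (8 : ℝ) ≤ x := by
      have h1 : X ^ (399 / 400 : ℝ) = (q : ℝ) ^ (V * (399 / 400)) := by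
        rw [hX, ← Real.rpow_mul hq0.le]
      have h2 : (q : ℝ) ^ (8 : ℝ) * 2 ≤ (q : ℝ) ^ (V * (399 / 400)) := by
        have h3 : (q : ℝ) ^ ((8 : ℝ) + 1.975) ≤ (q : ℝ) ^ (V * (399 / 400)) :=
          Real.rpow_le_rpow_of_exponent_le hq1 (by linarith only [hV])
        rw [Real.rpow_add hq0] at h3
        have h4 : (2 : ℝ) ≤ (q : ℝ) ^ (1.975 : ℝ) :=
          calc (2 : ℝ) = 2 ^ (1 : ℝ) := (Real.rpow_one 2).symm
            _ ≤ 2 ^ (1.975 : ℝ) := Real.rpow_le_rpow_of_exponent_le one_le_two (by norm_num)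
            _ ≤ (q : ℝ) ^ (1.975 : ℝ) := Real.rpow_le_rpow (by norm_num) hq2 (by norm_num)
        have h5 : 0 ≤ (q : ℝ) ^ (8 : ℝ) := Real.rpow_nonneg hq0.le _
        exact (mul_le_mul_of_nonneg_left h4 h5).trans h3
      rw [← h1] at h2
      linarith only [h2, hxlow]
    -- (x3) the range of `δ`
    have hδlow : x ^ (-(1 / 50 : ℝ)) / 4 ≤ δ := by
      rw [hδ_def]
      -- `x^{-1/50} ≤ (X^{399/400}/2)^{-1/50} = 2^{1/50} X^{-399/20000} ≤ 2 X^{-1/100}`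
      have h1 : x ^ (-(1 / 50 : ℝ)) ≤ (X ^ (399 / 400 : ℝ) / 2) ^ (-(1 / 50 : ℝ)) :=
        Real.rpow_le_rpow_of_nonpos (by positivity) hxlow (by norm_num)
      have h2 : (X ^ (399 / 400 : ℝ) / 2) ^ (-(1 / 50 : ℝ)) =
          X ^ (-(399 / 20000 : ℝ)) * 2 ^ (1 / 50 : ℝ) := by
        rw [Real.div_rpow (Real.rpow_nonneg hX0.le _) two_pos.le, ← Real.rpow_mul hX0.le,
          div_eq_mul_inv, ← Real.rpow_neg two_pos.le]
        norm_num
      have h3 : (2 : ℝ) ^ (1 / 50 : ℝ) ≤ 2 :=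
        calc (2 : ℝ) ^ (1 / 50 : ℝ) ≤ 2 ^ (1 : ℝ) := Real.rpow_le_rpow_of_exponent_le one_le_two (by norm_num)
          _ = 2 := Real.rpow_one 2
      have h4 : X ^ (-(399 / 20000 : ℝ)) ≤ X ^ (-(1 / 100 : ℝ)) :=
        Real.rpow_le_rpow_of_exponent_le hX1 (by norm_num)
      have h5 : 0 ≤ X ^ (-(399 / 20000 : ℝ)) := Real.rpow_nonneg hX0.le _
      have h6 : x ^ (-(1 / 50 : ℝ)) ≤ X ^ (-(1 / 100 : ℝ)) * 2 := by
        rw [h2] at h1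
        exact h1.trans (mul_le_mul h4 h3 (Real.rpow_nonneg two_pos.le _) (Real.rpow_nonneg hX0.le _))
      linarith only [h6]
    -- (x4) the range of `h`
    have hhx : (h : ℝ) ≤ 3 * A * x ^ (1 + 1 / 100 : ℝ) := by
      -- `X ≤ (2x)^{400/399} ≤ 3 x^{1+1/100}`
      have h1 : X ≤ (2 * x) ^ (400 / 399 : ℝ) := by
        have h2x : X ^ (399 / 400 : ℝ) ≤ 2 * x := by linarith only [hxlow]
        have := Real.rpow_le_rpow (Real.rpow_nonneg hX0.le _) h2x (show (0:ℝ) ≤ 400 / 399 by norm_num)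
        rwa [← Real.rpow_mul hX0.le, show (399 / 400 : ℝ) * (400 / 399) = 1 by norm_num, Real.rpow_one] at this
      have h2 : (2 * x) ^ (400 / 399 : ℝ) ≤ 3 * x ^ (1 + 1 / 100 : ℝ) := by
        rw [Real.mul_rpow two_pos.le hx0.le]
        have h3 : (2 : ℝ) ^ (400 / 399 : ℝ) ≤ 3 := by
          calc (2 : ℝ) ^ (400 / 399 : ℝ) ≤ 2 ^ (3 / 2 : ℝ) :=
                Real.rpow_le_rpow_of_exponent_le one_le_two (by norm_num)
            _ = 2 * Real.sqrt 2 := by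
                rw [show (3 / 2 : ℝ) = 1 + 1 / 2 by norm_num, Real.rpow_add two_pos, Real.rpow_one,
                  Real.sqrt_eq_rpow]
            _ ≤ 2 * (3 / 2) := by
                have : Real.sqrt 2 ≤ 3 / 2 := by
                  rw [Real.sqrt_le_left (by norm_num)]; norm_num
                linarith only [this]
            _ = 3 := by norm_num
        have h4 : x ^ (400 / 399 : ℝ) ≤ x ^ (1 + 1 / 100 : ℝ) :=
          Real.rpow_le_rpow_of_exponent_le hx1 (by norm_num)
        have h5 : 0 ≤ x ^ (400 / 399 : ℝ) := Real.rpow_nonneg hx0.le _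
        calc (2 : ℝ) ^ (400 / 399 : ℝ) * x ^ (400 / 399 : ℝ) ≤ 3 * x ^ (400 / 399 : ℝ) :=
              mul_le_mul_of_nonneg_right h3 h5
          _ ≤ 3 * x ^ (1 + 1 / 100 : ℝ) := by linarith only [h4]
      calc (h : ℝ) ≤ A * X := hhA
        _ ≤ A * (3 * x ^ (1 + 1 / 100 : ℝ)) := mul_le_mul_of_nonneg_left (h1.trans h2) hA.le
        _ = 3 * A * x ^ (1 + 1 / 100 : ℝ) := by ring
    -- (x5) the logarithms
    have hlogx_up : Real.log x ≤ Real.log X := Real.log_le_log hx0 (hxX.trans (half_le_self hX0.le))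
    have hlogx_low : 0.89 * Real.log X ≤ Real.log x := by
      have h1 : Real.log (X ^ (399 / 400 : ℝ) / 2) ≤ Real.log x := Real.log_le_log (by positivity) hxlow
      rw [Real.log_div hX399.ne' two_ne_zero, Real.log_rpow hX0] at h1
      linarith only [h1, hlogXge, hlogX0]
    -- (x6) smoothing the block
    have hsmooth : |(∑ n ∈ Ioc ⌊x⌋₊ ⌊2 * x⌋₊, a n) - ∑ n ∈ Icc 1 ⌊2 * x⌋₊, g (n / x) * a n| ≤
        (2 * δ * x + 2) * L ^ 2 :=
      abs_sum_Ioc_sub_sum_smooth_le hx1 hδ0 hδhalf ha0 fun n hn => by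
        obtain ⟨hn1, hn2⟩ := Finset.mem_Icc.mp hn
        refine haL n hn1 (le_trans ?_ (show 2 * x ≤ 2 * X by linarith only [hxX, hX0]))
        exact le_trans (by exact_mod_cast hn2) (Nat.floor_le (by positivity))
    -- (x7) the hypothesis on the block
    have hHx := H' q hq χ hprim hquad η hη hL x hq8 δ hδlow hδhalf h hh hhx
    have hEx : Real.exp (-(2 * C) * Real.sqrt (Real.log x / Real.log q * Real.log η)) +
        Real.exp (-(2 * C) * Real.log x ^ (3 / 5 - ε)) +
        Real.log x / Real.log q * Real.log η ^ (6 : ℕ) / η ≤ E := by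
      have := errorTerms_dyadic_le (by linarith : (0:ℝ) ≤ C) hε hlogX0 hlogx_low hlogx_up hlogq hη
      rw [hE_def, hVeq]
      exact this
    have hmain : |(∑ n ∈ Icc 1 ⌊2 * x⌋₊, g (n / x) * a n) - x * I * 𝔖 * (1 + corr)| ≤ K' * hφ * x * E := by
      refine hHx.trans ?_
      exact mul_le_mul_of_nonneg_left hEx (by positivity)
    -- combine
    rw [show ⌊X / 2 ^ j⌋₊ = ⌊2 * x⌋₊ by rw [hx2]]
    calc |(∑ n ∈ Ioc ⌊x⌋₊ ⌊2 * x⌋₊, a n) - x * I * 𝔖 * (1 + corr)|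
        ≤ |(∑ n ∈ Ioc ⌊x⌋₊ ⌊2 * x⌋₊, a n) - ∑ n ∈ Icc 1 ⌊2 * x⌋₊, g (n / x) * a n| +
            |(∑ n ∈ Icc 1 ⌊2 * x⌋₊, g (n / x) * a n) - x * I * 𝔖 * (1 + corr)| := abs_sub_le _ _ _
      _ ≤ (2 * δ * x + 2) * L ^ 2 + K' * hφ * x * E := add_le_add hsmooth hmain
  -- summing the blocks
  have hsumx : ∑ j ∈ Finset.range J, X / 2 ^ (j + 1) = X - X / 2 ^ J := sum_dyadic_scales X J
  have hXJ0 : 0 ≤ X / 2 ^ J := by positivity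
  have hblocks : |(∑ j ∈ Finset.range J, ∑ n ∈ Ioc ⌊X / 2 ^ (j + 1)⌋₊ ⌊X / 2 ^ j⌋₊, a n) -
      (X - X / 2 ^ J) * I * 𝔖 * (1 + corr)| ≤ (2 * δ * X + 2 * J) * L ^ 2 + K' * hφ * X * E := by
    have hrew : (X - X / 2 ^ J) * I * 𝔖 * (1 + corr) =
        ∑ j ∈ Finset.range J, X / 2 ^ (j + 1) * I * 𝔖 * (1 + corr) := by
      rw [← hsumx, Finset.sum_mul, Finset.sum_mul, Finset.sum_mul]
    rw [hrew, ← Finset.sum_sub_distrib]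
    refine (Finset.abs_sum_le_sum_abs _ _).trans ?_
    refine (Finset.sum_le_sum hblock).trans ?_
    rw [Finset.sum_add_distrib]
    have h1 : ∑ j ∈ Finset.range J, (2 * δ * (X / 2 ^ (j + 1)) + 2) * L ^ 2 =
        (2 * δ * (X - X / 2 ^ J) + 2 * J) * L ^ 2 := by
      rw [← Finset.sum_mul, Finset.sum_add_distrib, ← Finset.mul_sum, hsumx, Finset.sum_const,
        Finset.card_range, nsmul_eq_mul]
      ring
    have h2 : ∑ j ∈ Finset.range J, K' * hφ * (X / 2 ^ (j + 1)) * E = K' * hφ * (X - X / 2 ^ J) * E := by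
      rw [← hsumx, Finset.mul_sum, Finset.sum_mul]
    rw [h1, h2]
    have h3 : 0 ≤ K' * hφ * E := by positivity
    have h4 : 0 ≤ 2 * δ * L ^ 2 := by positivity
    have h5 : (2 * δ * (X - X / 2 ^ J) + 2 * J) * L ^ 2 ≤ (2 * δ * X + 2 * J) * L ^ 2 := by
      refine mul_le_mul_of_nonneg_right ?_ (by positivity)
      have : 0 ≤ 2 * δ * (X / 2 ^ J) := by positivity
      linarith only [this]
    have h6 : K' * hφ * (X - X / 2 ^ J) * E ≤ K' * hφ * X * E := by
      refine mul_le_mul_of_nonneg_right (mul_le_mul_of_nonneg_left ?_ (by positivity)) hE0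
      linarith only [hXJ0]
    exact add_le_add h5 h6
  -- the initial segment
  have hinit : |∑ n ∈ Icc 1 ⌊X / 2 ^ J⌋₊, a n| ≤ X ^ (399 / 400 : ℝ) * L ^ 2 := by
    rw [abs_of_nonneg (Finset.sum_nonneg fun n _ => ha0 n)]
    calc ∑ n ∈ Icc 1 ⌊X / 2 ^ J⌋₊, a n ≤ ∑ n ∈ Icc 1 ⌊X / 2 ^ J⌋₊, L ^ 2 := by
          refine Finset.sum_le_sum fun n hn => ?_
          obtain ⟨hn1, hn2⟩ := Finset.mem_Icc.mp hn
          refine haL n hn1 (le_trans (le_trans (by exact_mod_cast hn2) (Nat.floor_le hXJ0)) ?_)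
          have : X / 2 ^ J ≤ X := div_le_self hX0.le (one_le_pow₀ one_le_two)
          linarith only [this, hX0]
      _ = (⌊X / 2 ^ J⌋₊ : ℝ) * L ^ 2 := by rw [Finset.sum_const, Nat.card_Icc, nsmul_eq_mul]; simp
      _ ≤ X ^ (399 / 400 : ℝ) * L ^ 2 := by
          refine mul_le_mul_of_nonneg_right ((Nat.floor_le hXJ0).trans hXJ.le) (by positivity)
  -- the main terms
  have hmainterm : |(X - X / 2 ^ J) * I * 𝔖 * (1 + corr) - X * 𝔖 * (1 + corr)| ≤
      12 * hφ * (X ^ (99 / 100 : ℝ) + X ^ (399 / 400 : ℝ)) := by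
    have e : (X - X / 2 ^ J) * I * 𝔖 * (1 + corr) - X * 𝔖 * (1 + corr) =
        -((X * (1 - I) + X / 2 ^ J * I) * (𝔖 * (1 + corr))) := by ring
    rw [e, abs_neg, abs_mul, abs_mul]
    have h1 : |X * (1 - I) + X / 2 ^ J * I| ≤ X ^ (99 / 100 : ℝ) + X ^ (399 / 400 : ℝ) := by
      have hI3 : 0 ≤ X * (1 - I) := mul_nonneg hX0.le (by linarith only [hI1])
      have hI4 : 0 ≤ X / 2 ^ J * I := mul_nonneg hXJ0 hI0
      rw [abs_of_nonneg (by linarith only [hI3, hI4])]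
      have hI5 : X * (1 - I) ≤ 2 * δ * X := by
        have := mul_le_mul_of_nonneg_left (show 1 - I ≤ 2 * δ by linarith only [hI2]) hX0.le
        linarith only [this]
      have hI6 : X / 2 ^ J * I ≤ X / 2 ^ J := mul_le_of_le_one_right hXJ0 hI1
      linarith only [hI5, hI6, hδX, hXJ]
    have h2 : |𝔖| * |1 + corr| ≤ 6 * hφ * 2 := by
      rw [abs_of_nonneg h𝔖0]
      exact mul_le_mul h𝔖le hcorr1 (abs_nonneg _) (by positivity)
    have h3 : 0 ≤ |𝔖| * |1 + corr| := by positivity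
    calc |X * (1 - I) + X / 2 ^ J * I| * (|𝔖| * |1 + corr|)
        ≤ (X ^ (99 / 100 : ℝ) + X ^ (399 / 400 : ℝ)) * (6 * hφ * 2) :=
          mul_le_mul h1 h2 h3 (by positivity)
      _ = 12 * hφ * (X ^ (99 / 100 : ℝ) + X ^ (399 / 400 : ℝ)) := by ring
  -- the polynomially small errors
  have hX99 : X ^ (99 / 100 : ℝ) ≤ X ^ (399 / 400 : ℝ) := Real.rpow_le_rpow_of_exponent_le hX1 (by norm_num)
  have hX399_1 : 1 ≤ X ^ (399 / 400 : ℝ) := Real.one_le_rpow hX1 (by norm_num)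
  have hL3 : L ^ 3 ≤ 2000 ^ 3 * (3 + A) * X ^ (3 / 2000 : ℝ) := by
    have h1 := log_pow_three_le (show (1 : ℝ) ≤ (3 + A) * X by linarith)
    rw [← hL_def, Real.mul_rpow (by linarith) hX0.le] at h1
    have h2 : (3 + A) ^ (3 / 2000 : ℝ) ≤ 3 + A := by
      conv_rhs => rw [← Real.rpow_one (3 + A)]
      exact Real.rpow_le_rpow_of_exponent_le (by linarith) (by norm_num)
    have h3 : 0 ≤ X ^ (3 / 2000 : ℝ) := Real.rpow_nonneg hX0.le _
    calc L ^ 3 ≤ 2000 ^ 3 * ((3 + A) ^ (3 / 2000 : ℝ) * X ^ (3 / 2000 : ℝ)) := h1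
      _ ≤ 2000 ^ 3 * ((3 + A) * X ^ (3 / 2000 : ℝ)) := by gcongr
      _ = 2000 ^ 3 * (3 + A) * X ^ (3 / 2000 : ℝ) := by ring
  have hstuff : X ^ (399 / 400 : ℝ) * L ^ 2 + (2 * δ * X + 2 * J) * L ^ 2 +
      12 * hφ * (X ^ (99 / 100 : ℝ) + X ^ (399 / 400 : ℝ)) ≤ KA * hφ * X * X ^ (-(1 / 1000 : ℝ)) := by
    rw [hδX]
    have hpoly := poly_errors_le hX399_1 hX99 hL1 hhφ1 hJL
    have hX' : X ^ (399 / 400 : ℝ) * X ^ (3 / 2000 : ℝ) = X * X ^ (-(1 / 1000 : ℝ)) := by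
      rw [← Real.rpow_add hX0, show (399 / 400 : ℝ) + 3 / 2000 = 1 + -(1 / 1000) by norm_num,
        Real.rpow_add hX0, Real.rpow_one]
    have h4 : 30 * hφ * L ^ 3 * X ^ (399 / 400 : ℝ) ≤ KA * hφ * X * X ^ (-(1 / 1000 : ℝ)) := by
      have hφ0 : 0 ≤ hφ := by linarith only [hhφ1]
      calc 30 * hφ * L ^ 3 * X ^ (399 / 400 : ℝ)
          ≤ 30 * hφ * (2000 ^ 3 * (3 + A) * X ^ (3 / 2000 : ℝ)) * X ^ (399 / 400 : ℝ) :=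
            mul_le_mul_of_nonneg_right (mul_le_mul_of_nonneg_left hL3 (by positivity))
              (Real.rpow_nonneg hX0.le _)
        _ = KA * hφ * (X ^ (399 / 400 : ℝ) * X ^ (3 / 2000 : ℝ)) := by rw [hKA]; ring
        _ = KA * hφ * X * X ^ (-(1 / 1000 : ℝ)) := by rw [hX']; ring
    exact hpoly.trans h4
  have habsorb : KA * hφ * X * X ^ (-(1 / 1000 : ℝ)) ≤ KA * Kabs * hφ * X * E := by
    have h1 := Habs X hX3
    calc KA * hφ * X * X ^ (-(1 / 1000 : ℝ)) ≤ KA * hφ * X * (Kabs * Real.exp (-C * Real.log X ^ (3 / 5 - ε))) :=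
          mul_le_mul_of_nonneg_left h1 (by positivity)
      _ ≤ KA * hφ * X * (Kabs * E) := by gcongr
      _ = KA * Kabs * hφ * X * E := by ring
  -- assemble
  rw [sum_Icc_eq_sum_add_sum_dyadic a hX0.le J]
  have e : (∑ n ∈ Icc 1 ⌊X / 2 ^ J⌋₊, a n) +
      (∑ j ∈ Finset.range J, ∑ n ∈ Ioc ⌊X / 2 ^ (j + 1)⌋₊ ⌊X / 2 ^ j⌋₊, a n) - X * 𝔖 * (1 + corr) =
      (∑ n ∈ Icc 1 ⌊X / 2 ^ J⌋₊, a n) +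
      ((∑ j ∈ Finset.range J, ∑ n ∈ Ioc ⌊X / 2 ^ (j + 1)⌋₊ ⌊X / 2 ^ j⌋₊, a n) -
        (X - X / 2 ^ J) * I * 𝔖 * (1 + corr)) +
      ((X - X / 2 ^ J) * I * 𝔖 * (1 + corr) - X * 𝔖 * (1 + corr)) := by ring
  rw [e]
  calc |(∑ n ∈ Icc 1 ⌊X / 2 ^ J⌋₊, a n) +
        ((∑ j ∈ Finset.range J, ∑ n ∈ Ioc ⌊X / 2 ^ (j + 1)⌋₊ ⌊X / 2 ^ j⌋₊, a n) -
          (X - X / 2 ^ J) * I * 𝔖 * (1 + corr)) +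
        ((X - X / 2 ^ J) * I * 𝔖 * (1 + corr) - X * 𝔖 * (1 + corr))|
      ≤ |∑ n ∈ Icc 1 ⌊X / 2 ^ J⌋₊, a n| +
        |(∑ j ∈ Finset.range J, ∑ n ∈ Ioc ⌊X / 2 ^ (j + 1)⌋₊ ⌊X / 2 ^ j⌋₊, a n) -
          (X - X / 2 ^ J) * I * 𝔖 * (1 + corr)| +
        |(X - X / 2 ^ J) * I * 𝔖 * (1 + corr) - X * 𝔖 * (1 + corr)| := abs_add_three _ _ _
    _ ≤ X ^ (399 / 400 : ℝ) * L ^ 2 + ((2 * δ * X + 2 * J) * L ^ 2 + K' * hφ * X * E) +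
        12 * hφ * (X ^ (99 / 100 : ℝ) + X ^ (399 / 400 : ℝ)) := add_le_add (add_le_add hinit hblocks) hmainterm
    _ ≤ K' * hφ * X * E + KA * Kabs * hφ * X * E := by linarith [hstuff, habsorb]
    _ = (K' + KA * Kabs) * ((h : ℝ) / (Nat.totient h : ℝ)) * X *
        (Real.exp (-C * Real.sqrt (V * Real.log η)) + Real.exp (-C * Real.log X ^ (3 / 5 - ε)) +
          V * Real.log η ^ (6 : ℕ) / η) := by rw [hhφ, hE_def]; ring

/-! ### The reduction with Matomäki–Merikoski-compatible parameters -/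

namespace MMSmoothing

/-- **`X^{−κ} ≤ K exp(−C (log X)^{3/5−ε})`** for all `X ≥ 3`, any `κ > 0`, with `K = K(κ, C, ε)`
(`ε > 0`): the general-exponent form of `exists_rpow_neg_le_mul_exp` (same proof, `C t^a ≤ κt + C(C/κ)^{a/(1−a)}`).
[folklore] -/
theorem exists_rpow_neg_le_mul_exp' {κ : ℝ} (hκ0 : 0 < κ) (C : ℝ) {ε : ℝ} (hε : 0 < ε) :
    ∃ K : ℝ, 0 < K ∧ ∀ X : ℝ, 3 ≤ X →
      X ^ (-κ) ≤ K * Real.exp (-C * Real.log X ^ (3 / 5 - ε)) := by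
  set a : ℝ := 3 / 5 - ε with ha
  have ha1 : a < 1 := by rw [ha]; linarith
  rcases le_or_gt C 0 with hC | hC
  · -- `C ≤ 0`: the exponential is `≥ 1 ≥ X^{-κ}`
    refine ⟨1, one_pos, fun X hX => ?_⟩
    have hX1 : 1 ≤ X := by linarith
    have ht : 0 ≤ Real.log X ^ a := Real.rpow_nonneg (Real.log_nonneg hX1) a
    have h1 : X ^ (-κ) ≤ 1 := Real.rpow_le_one_of_one_le_of_nonpos hX1 (by linarith)
    have h2 : 1 ≤ Real.exp (-C * Real.log X ^ a) := Real.one_le_exp (by nlinarith)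
    linarith
  · rcases le_or_gt a 0 with ha0 | ha0
    · -- `a ≤ 0`: `(log X)^a ≤ 1`, so the exponential is `≥ e^{-C}`
      refine ⟨Real.exp C, Real.exp_pos C, fun X hX => ?_⟩
      have hX1 : 1 ≤ X := by linarith
      have hlog1 : 1 ≤ Real.log X := by
        rw [← Real.log_exp 1]
        refine Real.log_le_log (Real.exp_pos 1) (le_trans ?_ hX)
        linarith [Real.exp_one_lt_d9]
      have ht : Real.log X ^ a ≤ 1 := Real.rpow_le_one_of_one_le_of_nonpos hlog1 ha0
      have h1 : X ^ (-κ) ≤ 1 := Real.rpow_le_one_of_one_le_of_nonpos hX1 (by linarith)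
      have h2 : Real.exp (-C) ≤ Real.exp (-C * Real.log X ^ a) := Real.exp_le_exp.mpr (by nlinarith)
      have h3 : Real.exp C * Real.exp (-C) = 1 := by rw [← Real.exp_add]; simp
      nlinarith [Real.exp_pos C, Real.exp_pos (-C)]
    · -- `0 < a < 1`
      set D : ℝ := C * (C / κ) ^ (a / (1 - a)) with hD
      refine ⟨Real.exp D, Real.exp_pos D, fun X hX => ?_⟩
      have hX0 : 0 < X := by linarith
      have hX1 : 1 ≤ X := by linarith
      have hlog1 : 1 ≤ Real.log X := by
        rw [← Real.log_exp 1]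
        refine Real.log_le_log (Real.exp_pos 1) (le_trans ?_ hX)
        linarith [Real.exp_one_lt_d9]
      set t : ℝ := Real.log X with ht
      have ht0 : 0 < t := by linarith
      -- key: `C t^a ≤ κ t + D`
      have hkey : C * t ^ a ≤ κ * t + D := by
        rcases le_or_gt (C / κ) (t ^ (1 - a)) with hcase | hcase
        · -- `t^{1-a} ≥ C/κ`: `C t^a = C t / t^{1-a} ≤ κ t`
          have h1a : 0 < t ^ (1 - a) := Real.rpow_pos_of_pos ht0 _
          have hta : t ^ a = t / t ^ (1 - a) := by
            rw [eq_div_iff h1a.ne', ← Real.rpow_add ht0]; simp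
          rw [hta]
          have : C * (t / t ^ (1 - a)) ≤ κ * t := by
            rw [mul_div_assoc', div_le_iff₀ h1a]
            have := mul_le_mul_of_nonneg_left hcase (show 0 ≤ κ * t by positivity)
            calc C * t = κ * t * (C / κ) := by field_simp
              _ ≤ κ * t * t ^ (1 - a) := this
          have hD0 : 0 ≤ D := by positivity
          linarith
        · -- `t^{1-a} < C/κ`: `t < (C/κ)^{1/(1-a)}` and `t^a < (C/κ)^{a/(1-a)}`
          have h1a0 : 0 < 1 - a := by linarith
          have htlt : t < (C / κ) ^ (1 / (1 - a)) := by
            have := Real.rpow_lt_rpow (Real.rpow_nonneg ht0.le _) hcase (one_div_pos.mpr h1a0)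
            rwa [← Real.rpow_mul ht0.le, mul_one_div_cancel h1a0.ne', Real.rpow_one] at this
          have hta : t ^ a ≤ (C / κ) ^ (a / (1 - a)) := by
            have := Real.rpow_le_rpow ht0.le htlt.le ha0.le
            rwa [← Real.rpow_mul (by positivity), show 1 / (1 - a) * a = a / (1 - a) by ring] at this
          have : C * t ^ a ≤ D := by rw [hD]; exact mul_le_mul_of_nonneg_left hta hC.le
          nlinarith
      -- conclude: `X^{-κ} = exp(-κ t) ≤ exp(D - C t^a) = e^D exp(-C t^a)`
      have hXκ : X ^ (-κ) = Real.exp (-κ * t) := by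
        rw [Real.rpow_def_of_pos hX0, ht]; ring_nf
      rw [hXκ, ← Real.exp_add]
      exact Real.exp_le_exp.mpr (by linarith)

/-- `(log Y)³ ≤ (3/s)³ Y^{s}` for `Y ≥ 1`, `s > 0` (`log Y ≤ Y^{s/3}/(s/3)`). [folklore] -/
theorem log_pow_three_le_rpow {s Y : ℝ} (hs : 0 < s) (hY : 1 ≤ Y) :
    Real.log Y ^ 3 ≤ (3 / s) ^ 3 * Y ^ s := by
  have h1 : Real.log Y ≤ Y ^ (s / 3) / (s / 3) := Real.log_le_rpow_div (by linarith) (by positivity)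
  have h2 : Real.log Y ≤ 3 / s * Y ^ (s / 3) := by
    rw [div_div_eq_mul_div] at h1
    calc Real.log Y ≤ Y ^ (s / 3) * 3 / s := h1
      _ = 3 / s * Y ^ (s / 3) := by ring
  have h0 : 0 ≤ Real.log Y := Real.log_nonneg hY
  calc Real.log Y ^ 3 ≤ (3 / s * Y ^ (s / 3)) ^ 3 := pow_le_pow_left₀ h0 h2 3
    _ = (3 / s) ^ 3 * (Y ^ (s / 3)) ^ (3 : ℕ) := by ring
    _ = (3 / s) ^ 3 * Y ^ s := by
        rw [← Real.rpow_natCast (Y ^ (s / 3)) 3, ← Real.rpow_mul (by linarith)]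
        congr 1; push_cast; ring_nf

/-- There is no primitive Dirichlet character of level `2`: `(ℤ/2)ˣ` is trivial, so every character
mod `2` is the trivial one, of conductor `1`. [folklore] -/
theorem not_isPrimitive_level_two (χ : DirichletCharacter ℂ 2) : ¬ χ.IsPrimitive := by
  have hχ : χ = 1 := by
    refine MulChar.ext fun u => ?_
    have hsub : Subsingleton (ZMod 2)ˣ := by
      rw [← Fintype.card_le_one_iff_subsingleton, ZMod.card_units_eq_totient]
      norm_num [Nat.totient_prime Nat.prime_two]
    rw [Subsingleton.elim u 1]
    simp
  intro hprim
  rw [DirichletCharacter.isPrimitive_def, hχ, DirichletCharacter.conductor_one] at hprim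
  omega

end MMSmoothing

set_option maxHeartbeats 800000 in
/-- **Matomäki–Merikoski 2023, Theorem 1.3 from its smoothed dyadic form — parameters as in the
source.** The variant of `MatomakiMerikoski2023_pairCorrelation_of_smoothed` whose hypothesis `H'` is
restricted to the range in which §§5–7 of the source operate: ONLY `q ≥ 3` (there is no primitive
character mod `2`, `MMSmoothing.not_isPrimitive_level_two`), `x ≥ q^{37/4}` (so that the error
`δ^{−3} X^{7/9} q²` of Proposition 2.3 is a power saving: `3/999 + 7/9 + 8/37 < 1`),
`x^{−1/999}/4 ≤ δ ≤ min(x^{−1/1000}, 1/2)` (the source's `δ = X^{−ε}`), and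
`1 ≤ h ≤ A x^{1+1/3999}` (the source's `h ≤ X^{1+ε/2}`, compatible with `M₂N₂ ≪ δ^{−1}X` in
Proposition 2.3).  Proof as for the sibling theorem with `δ = X^{−1/1000}/2`, `2^J ≍ X^{1/4000}`
(so every dyadic scale satisfies `x ≥ X^{3999/4000}/2 ≥ q^{9.9975}/2 ≥ q^{37/4}` as `q ≥ 3`),
the polynomially small errors `≪_A (h/φ(h)) X^{1−1/8000}` (`log³ ≪ X^{1/8000}`,
`log_pow_three_le_rpow`), absorbed by `X^{−1/8000} ≪ exp(−C (log X)^{3/5−ε})`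
(`exists_rpow_neg_le_mul_exp'`). [cite: MatomakiMerikoski2023, §2] -/
theorem MatomakiMerikoski2023_pairCorrelation_of_smoothed'
    (H : ∀ C : ℝ, 1 ≤ C → ∀ ε : ℝ, 0 < ε → ∀ A : ℝ, 0 < A → ∃ K : ℝ, 0 < K ∧
      ∀ (q : ℕ) [NeZero q], 3 ≤ q → ∀ χ : DirichletCharacter ℂ q, χ.IsPrimitive → χ.IsQuadratic →
        ∀ η : ℝ, 10 ≤ η → χ.LFunction ((1 - 1 / (η * Real.log q) : ℝ) : ℂ) = 0 →
          ∀ x : ℝ, (q : ℝ) ^ (37 / 4 : ℝ) ≤ x →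
            ∀ δ : ℝ, x ^ (-(1 / 999 : ℝ)) / 4 ≤ δ → δ ≤ x ^ (-(1 / 1000 : ℝ)) → δ ≤ 1 / 2 →
            ∀ h : ℕ, 1 ≤ h → (h : ℝ) ≤ A * x ^ (1 + 1 / 3999 : ℝ) →
              |(∑ n ∈ Icc 1 ⌊2 * x⌋₊,
                  plateauCutoff (1 + δ) (2 - δ) δ (n / x) * (Λ n * Λ (n + h))) -
                  x * (∫ u, plateauCutoff (1 + δ) (2 - δ) δ u) * goldbachSingularSeries h *
                    (1 + if Nat.totient (2 ^ padicValNat 2 q) ∣ h then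
                          (-1 : ℝ) ^ (h / Nat.totient (2 ^ padicValNat 2 q)) *
                            ∏ p ∈ (q / 2 ^ padicValNat 2 q).primeFactors.filter (fun p => ¬ p ∣ h),
                              (-1 : ℝ) / ((p : ℝ) - 2)
                        else 0)| ≤
                K * ((h : ℝ) / (Nat.totient h : ℝ)) * x *
                  (Real.exp (-C * Real.sqrt (Real.log x / Real.log q * Real.log η)) +
                    Real.exp (-C * Real.log x ^ (3 / 5 - ε)) +
                    Real.log x / Real.log q * Real.log η ^ (6 : ℕ) / η)) :
    MatomakiMerikoski2023_pairCorrelation := by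
  intro C hC ε hε A hA
  obtain ⟨K', hK', H'⟩ := H (2 * C) (by linarith) ε hε (3 * A) (by positivity)
  obtain ⟨Kabs, hKabs, Habs⟩ := exists_rpow_neg_le_mul_exp' (show (0 : ℝ) < 1 / 8000 by norm_num) C hε
  set KA : ℝ := 30 * 24000 ^ 3 * (3 + A) with hKA
  have hKA0 : 0 < KA := by positivity
  refine ⟨K' + KA * Kabs, by positivity, ?_⟩
  intro q _ hq χ hprim hquad η hη hL V X hV hX h hh hhA
  -- `q = 2` carries no primitive character
  by_cases hq2eq : q = 2
  · subst hq2eq; exact absurd hprim (not_isPrimitive_level_two χ)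
  have hq3 : 3 ≤ q := by omega
  have hq3' : (3 : ℝ) ≤ q := by exact_mod_cast hq3
  -- the correction factor and the singular series
  set corr : ℝ := (if Nat.totient (2 ^ padicValNat 2 q) ∣ h then
      (-1 : ℝ) ^ (h / Nat.totient (2 ^ padicValNat 2 q)) *
        ∏ p ∈ (q / 2 ^ padicValNat 2 q).primeFactors.filter (fun p => ¬ p ∣ h),
          (-1 : ℝ) / ((p : ℝ) - 2)
      else 0) with hcorr_def
  have hcorr : |corr| ≤ 1 := abs_corr_le_one q h
  have hcorr1 : |1 + corr| ≤ 2 := by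
    have := abs_add_le (1 : ℝ) corr; rw [abs_one] at this; linarith
  set hφ : ℝ := (h : ℝ) / (Nat.totient h : ℝ) with hhφ
  have hh0 : h ≠ 0 := by omega
  have hφpos : (0 : ℝ) < Nat.totient h := by exact_mod_cast Nat.totient_pos.mpr (by omega)
  have hhφ1 : 1 ≤ hφ := by rw [hhφ, le_div_iff₀ hφpos, one_mul]; exact_mod_cast Nat.totient_le h
  set 𝔖 : ℝ := goldbachSingularSeries h with h𝔖
  have h𝔖0 : 0 ≤ 𝔖 := Literature.NumberTheory.Sieve.SingularSeriesMean.goldbachSingularSeries_nonneg h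
  have h𝔖le : 𝔖 ≤ 6 * hφ := goldbachSingularSeries_le_mul_div_totient hh0
  -- basic sizes
  have hq2 : (2 : ℝ) ≤ q := by exact_mod_cast hq
  have hq0 : (0 : ℝ) < q := by linarith
  have hq1 : (1 : ℝ) ≤ q := by linarith
  have hlogq : 0 < Real.log q := Real.log_pos (by linarith)
  have hlog2 : Real.log 2 ≤ Real.log q := Real.log_le_log two_pos hq2
  have hlog2pos : 0 < Real.log 2 := Real.log_pos one_lt_two
  have hV0 : 0 < V := by linarith
  have hX0 : 0 < X := by rw [hX]; exact Real.rpow_pos_of_pos hq0 V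
  have hlogX : Real.log X = V * Real.log q := by rw [hX, Real.log_rpow hq0]
  have hlogXge : 10 * Real.log 2 ≤ Real.log X := by
    rw [hlogX]; exact mul_le_mul hV hlog2 hlog2pos.le (by linarith)
  have hlogX0 : 0 < Real.log X := by linarith only [hlogXge, hlog2pos]
  have hlog2d : (0.6931471803 : ℝ) < Real.log 2 := Real.log_two_gt_d9
  have hX1024 : (1024 : ℝ) ≤ X := by
    have h1 : Real.log 1024 = 10 * Real.log 2 := by
      rw [show (1024 : ℝ) = 2 ^ 10 by norm_num, Real.log_pow]; norm_num
    have h2 : Real.log 1024 ≤ Real.log X := by rw [h1]; exact hlogXge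
    exact (Real.log_le_log_iff (by norm_num) hX0).mp h2
  have hX3 : (3 : ℝ) ≤ X := by linarith
  have hX1 : (1 : ℝ) ≤ X := by linarith
  have hVeq : V = Real.log X / Real.log q := by rw [hlogX]; field_simp
  -- the summand and its trivial bound
  set a : ℕ → ℝ := fun n => Λ n * Λ (n + h) with ha_def
  have ha0 : ∀ n, 0 ≤ a n := fun n => vonMangoldt_mul_nonneg n (n + h)
  set L : ℝ := Real.log ((3 + A) * X) with hL_def
  have h3AX : 3 ≤ (3 + A) * X := by
    have e : (3 + A) * X = 3 * X + A * X := by ring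
    have hAX : 0 ≤ A * X := by positivity
    rw [e]; linarith only [hX1, hAX]
  have hL1 : 1 ≤ L := by
    rw [hL_def, ← Real.log_exp 1]
    refine Real.log_le_log (Real.exp_pos 1) (le_trans ?_ h3AX)
    linarith [Real.exp_one_lt_d9]
  have hL0 : 0 < L := by linarith
  have haL : ∀ n : ℕ, 1 ≤ n → (n : ℝ) ≤ 2 * X → a n ≤ L ^ 2 := by
    intro n hn1 hn2
    refine vonMangoldt_mul_le_log_sq ?_ hn1
    have e : (3 + A) * X = 2 * X + A * X + X := by ring
    rw [e]
    linarith only [hn2, hhA, hX0]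
  -- the parameters `δ` and `J`
  set δ : ℝ := X ^ (-(1 / 1000 : ℝ)) / 2 with hδ_def
  have hXpow : X ^ (-(1 / 1000 : ℝ)) ≤ 1 := Real.rpow_le_one_of_one_le_of_nonpos hX1 (by norm_num)
  have hXpow0 : 0 < X ^ (-(1 / 1000 : ℝ)) := Real.rpow_pos_of_pos hX0 _
  have hδ0 : 0 < δ := by positivity
  have hδhalf : δ ≤ 1 / 2 := by rw [hδ_def]; linarith
  have hδX : 2 * δ * X = X ^ (999 / 1000 : ℝ) := by
    rw [hδ_def, show (999 / 1000 : ℝ) = -(1 / 1000) + 1 by norm_num, Real.rpow_add hX0, Real.rpow_one]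
    ring
  set t : ℝ := Real.log X / (4000 * Real.log 2) with ht_def
  have ht0 : 0 ≤ t := by positivity
  set J : ℕ := ⌊t⌋₊ + 1 with hJ_def
  have h2t : (2 : ℝ) ^ t = X ^ (1 / 4000 : ℝ) := by
    rw [Real.rpow_def_of_pos two_pos, Real.rpow_def_of_pos hX0, ht_def]
    congr 1; field_simp
  have h2J_gt : X ^ (1 / 4000 : ℝ) < (2 : ℝ) ^ J := by
    rw [← h2t, ← Real.rpow_natCast 2 J]
    refine Real.rpow_lt_rpow_of_exponent_lt one_lt_two ?_
    rw [hJ_def]; push_cast; exact Nat.lt_floor_add_one t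
  have h2J_le : (2 : ℝ) ^ J ≤ 2 * X ^ (1 / 4000 : ℝ) := by
    rw [← h2t, hJ_def, pow_succ, mul_comm, ← Real.rpow_natCast 2 ⌊t⌋₊]
    exact mul_le_mul_of_nonneg_left (Real.rpow_le_rpow_of_exponent_le one_le_two (Nat.floor_le ht0)) two_pos.le
  have h2J_pos : (0 : ℝ) < 2 ^ J := pow_pos two_pos J
  have hXJ : X / 2 ^ J < X ^ (3999 / 4000 : ℝ) := by
    rw [div_lt_iff₀ h2J_pos]
    calc X = X ^ (3999 / 4000 : ℝ) * X ^ (1 / 4000 : ℝ) := by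
          rw [← Real.rpow_add hX0, show (3999 / 4000 : ℝ) + 1 / 4000 = 1 by norm_num, Real.rpow_one]
      _ < X ^ (3999 / 4000 : ℝ) * 2 ^ J := mul_lt_mul_of_pos_left h2J_gt (Real.rpow_pos_of_pos hX0 _)
  have hJL : (J : ℝ) ≤ 2 * L := by
    have h1 : (J : ℝ) ≤ t + 1 := by
      rw [hJ_def]; push_cast; linarith [Nat.floor_le ht0]
    have h2 : t ≤ Real.log X := by
      rw [ht_def, div_le_iff₀ (by positivity)]
      have h400 : (1 : ℝ) ≤ 4000 * Real.log 2 := by linarith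
      exact le_mul_of_one_le_right hlogX0.le h400
    have h3 : Real.log X ≤ L := by
      rw [hL_def]; refine Real.log_le_log hX0 ?_
      have e : (3 + A) * X = X + (2 + A) * X := by ring
      have hAX : 0 ≤ (2 + A) * X := by positivity
      rw [e]; linarith only [hAX]
    linarith only [h1, h2, h3, hL1]
  -- the common error function
  set E : ℝ := Real.exp (-C * Real.sqrt (V * Real.log η)) + Real.exp (-C * Real.log X ^ (3 / 5 - ε)) +
    V * Real.log η ^ (6 : ℕ) / η with hE_def
  have hη0 : 0 < η := by linarith
  have hE0 : 0 ≤ E := by positivity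
  have hEexp : Real.exp (-C * Real.log X ^ (3 / 5 - ε)) ≤ E := by
    rw [hE_def]
    have : 0 ≤ V * Real.log η ^ (6 : ℕ) / η := by
      have := Real.log_nonneg (show (1:ℝ) ≤ η by linarith); positivity
    linarith [Real.exp_pos (-C * Real.sqrt (V * Real.log η))]
  -- the weight and its integral
  set g : ℝ → ℝ := plateauCutoff (1 + δ) (2 - δ) δ with hg_def
  have hab : 1 + δ ≤ 2 - δ := by linarith
  set I : ℝ := ∫ u, g u with hI_def
  have hI1 : I ≤ 1 := by
    have := integral_plateauCutoff_le hδ0 hab; rw [← hg_def] at this; linarith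
  have hI2 : 1 - 2 * δ ≤ I := by
    have := sub_le_integral_plateauCutoff hδ0 hab; rw [← hg_def] at this; linarith
  have hI0 : 0 ≤ I := by linarith
  -- the blocks
  have hblock : ∀ j ∈ Finset.range J,
      |(∑ n ∈ Ioc ⌊X / 2 ^ (j + 1)⌋₊ ⌊X / 2 ^ j⌋₊, a n) -
          X / 2 ^ (j + 1) * I * 𝔖 * (1 + corr)| ≤
        (2 * δ * (X / 2 ^ (j + 1)) + 2) * L ^ 2 + K' * hφ * (X / 2 ^ (j + 1)) * E := by
    intro j hj
    have hjJ : j + 1 ≤ J := Finset.mem_range.mp hj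
    set x : ℝ := X / 2 ^ (j + 1) with hx_def
    have h2j : (0 : ℝ) < 2 ^ (j + 1) := pow_pos two_pos _
    have hx2 : 2 * x = X / 2 ^ j := by rw [hx_def, pow_succ]; field_simp
    have hxX : x ≤ X / 2 := by
      rw [hx_def, div_le_div_iff_of_pos_left hX0 h2j two_pos]
      calc (2 : ℝ) = 2 ^ 1 := by norm_num
        _ ≤ 2 ^ (j + 1) := pow_le_pow_right₀ one_le_two (by omega)
    have hxlow : X ^ (3999 / 4000 : ℝ) / 2 ≤ x := by
      -- `x = X/2^{j+1} ≥ X/2^J ≥ X^{3999/4000}/2`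
      have h1 : X / 2 ^ J ≤ x := by
        rw [hx_def]
        exact div_le_div_of_nonneg_left hX0.le h2j (pow_le_pow_right₀ one_le_two hjJ)
      have h2 : X ^ (3999 / 4000 : ℝ) / 2 ≤ X / 2 ^ J := by
        rw [div_le_div_iff₀ two_pos h2J_pos]
        calc X ^ (3999 / 4000 : ℝ) * 2 ^ J ≤ X ^ (3999 / 4000 : ℝ) * (2 * X ^ (1 / 4000 : ℝ)) :=
              mul_le_mul_of_nonneg_left h2J_le (Real.rpow_nonneg hX0.le _)
          _ = X * 2 := by
              rw [mul_comm (2 : ℝ), ← mul_assoc, ← Real.rpow_add hX0,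
                show (3999 / 4000 : ℝ) + 1 / 4000 = 1 by norm_num, Real.rpow_one]
      exact h2.trans h1
    have hX399 : 0 < X ^ (3999 / 4000 : ℝ) := Real.rpow_pos_of_pos hX0 _
    have hx0 : 0 < x := by linarith
    have hx1 : 1 ≤ x := by
      -- `X^{399/400} ≥ 1024^{399/400} ≥ 2`
      have : (2 : ℝ) ≤ X ^ (3999 / 4000 : ℝ) := by
        calc (2 : ℝ) ≤ 1024 ^ (3999 / 4000 : ℝ) := by
              have : (2 : ℝ) = 1024 ^ (1 / 10 : ℝ) := by
                rw [show (1024 : ℝ) = 2 ^ (10 : ℝ) by norm_num, ← Real.rpow_mul (by norm_num)]; norm_num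
              rw [this]
              exact Real.rpow_le_rpow_of_exponent_le (by norm_num) (by norm_num)
          _ ≤ X ^ (3999 / 4000 : ℝ) := Real.rpow_le_rpow (by norm_num) hX1024 (by norm_num)
      linarith only [this, hxlow]
    -- (x2) `q^{37/4} ≤ x` (uses `q ≥ 3`: `2 ≤ 3^{7/10} ≤ q^{7/10}`)
    have hq8 : (q : ℝ) ^ (37 / 4 : ℝ) ≤ x := by
      have h1 : X ^ (3999 / 4000 : ℝ) = (q : ℝ) ^ (V * (3999 / 4000)) := by
        rw [hX, ← Real.rpow_mul hq0.le]
      have h2 : (q : ℝ) ^ (37 / 4 : ℝ) * 2 ≤ (q : ℝ) ^ (V * (3999 / 4000)) := by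
        have h3 : (q : ℝ) ^ ((37 / 4 : ℝ) + 7 / 10) ≤ (q : ℝ) ^ (V * (3999 / 4000)) :=
          Real.rpow_le_rpow_of_exponent_le hq1 (by linarith only [hV])
        rw [Real.rpow_add hq0] at h3
        have h4 : (2 : ℝ) ≤ (q : ℝ) ^ (7 / 10 : ℝ) :=
          calc (2 : ℝ) = ((2 : ℝ) ^ (10 : ℕ)) ^ (1 / 10 : ℝ) := by
                rw [← Real.rpow_natCast, ← Real.rpow_mul (by norm_num)]; norm_num
            _ ≤ ((3 : ℝ) ^ (7 : ℕ)) ^ (1 / 10 : ℝ) := Real.rpow_le_rpow (by norm_num) (by norm_num) (by norm_num)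
            _ = (3 : ℝ) ^ (7 / 10 : ℝ) := by
                rw [← Real.rpow_natCast, ← Real.rpow_mul (by norm_num)]; norm_num
            _ ≤ (q : ℝ) ^ (7 / 10 : ℝ) := Real.rpow_le_rpow (by norm_num) hq3' (by norm_num)
        have h5 : 0 ≤ (q : ℝ) ^ (37 / 4 : ℝ) := Real.rpow_nonneg hq0.le _
        exact (mul_le_mul_of_nonneg_left h4 h5).trans h3
      rw [← h1] at h2
      linarith only [h2, hxlow]
    -- (x3) the range of `δ`
    have hδlow : x ^ (-(1 / 999 : ℝ)) / 4 ≤ δ := by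
      rw [hδ_def]
      -- `x^{-1/999} ≤ (X^{3999/4000}/2)^{-1/999} = 2^{1/999} X^{-3999/3996000} ≤ 2 X^{-1/1000}`
      have h1 : x ^ (-(1 / 999 : ℝ)) ≤ (X ^ (3999 / 4000 : ℝ) / 2) ^ (-(1 / 999 : ℝ)) :=
        Real.rpow_le_rpow_of_nonpos (by positivity) hxlow (by norm_num)
      have h2 : (X ^ (3999 / 4000 : ℝ) / 2) ^ (-(1 / 999 : ℝ)) =
          X ^ (-(3999 / 3996000 : ℝ)) * 2 ^ (1 / 999 : ℝ) := by
        rw [Real.div_rpow (Real.rpow_nonneg hX0.le _) two_pos.le, ← Real.rpow_mul hX0.le,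
          div_eq_mul_inv, ← Real.rpow_neg two_pos.le]
        norm_num
      have h3 : (2 : ℝ) ^ (1 / 999 : ℝ) ≤ 2 :=
        calc (2 : ℝ) ^ (1 / 999 : ℝ) ≤ 2 ^ (1 : ℝ) := Real.rpow_le_rpow_of_exponent_le one_le_two (by norm_num)
          _ = 2 := Real.rpow_one 2
      have h4 : X ^ (-(3999 / 3996000 : ℝ)) ≤ X ^ (-(1 / 1000 : ℝ)) :=
        Real.rpow_le_rpow_of_exponent_le hX1 (by norm_num)
      have h5 : 0 ≤ X ^ (-(3999 / 3996000 : ℝ)) := Real.rpow_nonneg hX0.le _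
      have h6 : x ^ (-(1 / 999 : ℝ)) ≤ X ^ (-(1 / 1000 : ℝ)) * 2 := by
        rw [h2] at h1
        exact h1.trans (mul_le_mul h4 h3 (Real.rpow_nonneg two_pos.le _) (Real.rpow_nonneg hX0.le _))
      linarith only [h6]
    have hδup : δ ≤ x ^ (-(1 / 1000 : ℝ)) := by
      rw [hδ_def]
      have h1 : X ^ (-(1 / 1000 : ℝ)) ≤ x ^ (-(1 / 1000 : ℝ)) :=
        Real.rpow_le_rpow_of_nonpos hx0 (hxX.trans (half_le_self hX0.le)) (by norm_num)
      have h2 : 0 ≤ X ^ (-(1 / 1000 : ℝ)) := Real.rpow_nonneg hX0.le _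
      linarith only [h1, h2]
    -- (x4) the range of `h`
    have hhx : (h : ℝ) ≤ 3 * A * x ^ (1 + 1 / 3999 : ℝ) := by
      -- `X ≤ (2x)^{4000/3999} ≤ 3 x^{1+1/3999}`
      have h1 : X ≤ (2 * x) ^ (4000 / 3999 : ℝ) := by
        have h2x : X ^ (3999 / 4000 : ℝ) ≤ 2 * x := by linarith only [hxlow]
        have := Real.rpow_le_rpow (Real.rpow_nonneg hX0.le _) h2x (show (0:ℝ) ≤ 4000 / 3999 by norm_num)
        rwa [← Real.rpow_mul hX0.le, show (3999 / 4000 : ℝ) * (4000 / 3999) = 1 by norm_num, Real.rpow_one] at this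
      have h2 : (2 * x) ^ (4000 / 3999 : ℝ) ≤ 3 * x ^ (1 + 1 / 3999 : ℝ) := by
        rw [Real.mul_rpow two_pos.le hx0.le]
        have h3 : (2 : ℝ) ^ (4000 / 3999 : ℝ) ≤ 3 := by
          calc (2 : ℝ) ^ (4000 / 3999 : ℝ) ≤ 2 ^ (3 / 2 : ℝ) :=
                Real.rpow_le_rpow_of_exponent_le one_le_two (by norm_num)
            _ = 2 * Real.sqrt 2 := by
                rw [show (3 / 2 : ℝ) = 1 + 1 / 2 by norm_num, Real.rpow_add two_pos, Real.rpow_one,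
                  Real.sqrt_eq_rpow]
            _ ≤ 2 * (3 / 2) := by
                have : Real.sqrt 2 ≤ 3 / 2 := by
                  rw [Real.sqrt_le_left (by norm_num)]; norm_num
                linarith only [this]
            _ = 3 := by norm_num
        have h4 : x ^ (4000 / 3999 : ℝ) ≤ x ^ (1 + 1 / 3999 : ℝ) :=
          Real.rpow_le_rpow_of_exponent_le hx1 (by norm_num)
        have h5 : 0 ≤ x ^ (4000 / 3999 : ℝ) := Real.rpow_nonneg hx0.le _
        calc (2 : ℝ) ^ (4000 / 3999 : ℝ) * x ^ (4000 / 3999 : ℝ) ≤ 3 * x ^ (4000 / 3999 : ℝ) :=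
              mul_le_mul_of_nonneg_right h3 h5
          _ ≤ 3 * x ^ (1 + 1 / 3999 : ℝ) := by linarith only [h4]
      calc (h : ℝ) ≤ A * X := hhA
        _ ≤ A * (3 * x ^ (1 + 1 / 3999 : ℝ)) := mul_le_mul_of_nonneg_left (h1.trans h2) hA.le
        _ = 3 * A * x ^ (1 + 1 / 3999 : ℝ) := by ring
    -- (x5) the logarithms
    have hlogx_up : Real.log x ≤ Real.log X := Real.log_le_log hx0 (hxX.trans (half_le_self hX0.le))
    have hlogx_low : 0.89 * Real.log X ≤ Real.log x := by
      have h1 : Real.log (X ^ (3999 / 4000 : ℝ) / 2) ≤ Real.log x := Real.log_le_log (by positivity) hxlow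
      rw [Real.log_div hX399.ne' two_ne_zero, Real.log_rpow hX0] at h1
      linarith only [h1, hlogXge, hlogX0]
    -- (x6) smoothing the block
    have hsmooth : |(∑ n ∈ Ioc ⌊x⌋₊ ⌊2 * x⌋₊, a n) - ∑ n ∈ Icc 1 ⌊2 * x⌋₊, g (n / x) * a n| ≤
        (2 * δ * x + 2) * L ^ 2 :=
      abs_sum_Ioc_sub_sum_smooth_le hx1 hδ0 hδhalf ha0 fun n hn => by
        obtain ⟨hn1, hn2⟩ := Finset.mem_Icc.mp hn
        refine haL n hn1 (le_trans ?_ (show 2 * x ≤ 2 * X by linarith only [hxX, hX0]))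
        exact le_trans (by exact_mod_cast hn2) (Nat.floor_le (by positivity))
    -- (x7) the hypothesis on the block
    have hHx := H' q hq3 χ hprim hquad η hη hL x hq8 δ hδlow hδup hδhalf h hh hhx
    have hEx : Real.exp (-(2 * C) * Real.sqrt (Real.log x / Real.log q * Real.log η)) +
        Real.exp (-(2 * C) * Real.log x ^ (3 / 5 - ε)) +
        Real.log x / Real.log q * Real.log η ^ (6 : ℕ) / η ≤ E := by
      have := errorTerms_dyadic_le (by linarith : (0:ℝ) ≤ C) hε hlogX0 hlogx_low hlogx_up hlogq hη
      rw [hE_def, hVeq]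
      exact this
    have hmain : |(∑ n ∈ Icc 1 ⌊2 * x⌋₊, g (n / x) * a n) - x * I * 𝔖 * (1 + corr)| ≤ K' * hφ * x * E := by
      refine hHx.trans ?_
      exact mul_le_mul_of_nonneg_left hEx (by positivity)
    -- combine
    rw [show ⌊X / 2 ^ j⌋₊ = ⌊2 * x⌋₊ by rw [hx2]]
    calc |(∑ n ∈ Ioc ⌊x⌋₊ ⌊2 * x⌋₊, a n) - x * I * 𝔖 * (1 + corr)|
        ≤ |(∑ n ∈ Ioc ⌊x⌋₊ ⌊2 * x⌋₊, a n) - ∑ n ∈ Icc 1 ⌊2 * x⌋₊, g (n / x) * a n| +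
            |(∑ n ∈ Icc 1 ⌊2 * x⌋₊, g (n / x) * a n) - x * I * 𝔖 * (1 + corr)| := abs_sub_le _ _ _
      _ ≤ (2 * δ * x + 2) * L ^ 2 + K' * hφ * x * E := add_le_add hsmooth hmain
  -- summing the blocks
  have hsumx : ∑ j ∈ Finset.range J, X / 2 ^ (j + 1) = X - X / 2 ^ J := sum_dyadic_scales X J
  have hXJ0 : 0 ≤ X / 2 ^ J := by positivity
  have hblocks : |(∑ j ∈ Finset.range J, ∑ n ∈ Ioc ⌊X / 2 ^ (j + 1)⌋₊ ⌊X / 2 ^ j⌋₊, a n) -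
      (X - X / 2 ^ J) * I * 𝔖 * (1 + corr)| ≤ (2 * δ * X + 2 * J) * L ^ 2 + K' * hφ * X * E := by
    have hrew : (X - X / 2 ^ J) * I * 𝔖 * (1 + corr) =
        ∑ j ∈ Finset.range J, X / 2 ^ (j + 1) * I * 𝔖 * (1 + corr) := by
      rw [← hsumx, Finset.sum_mul, Finset.sum_mul, Finset.sum_mul]
    rw [hrew, ← Finset.sum_sub_distrib]
    refine (Finset.abs_sum_le_sum_abs _ _).trans ?_
    refine (Finset.sum_le_sum hblock).trans ?_
    rw [Finset.sum_add_distrib]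
    have h1 : ∑ j ∈ Finset.range J, (2 * δ * (X / 2 ^ (j + 1)) + 2) * L ^ 2 =
        (2 * δ * (X - X / 2 ^ J) + 2 * J) * L ^ 2 := by
      rw [← Finset.sum_mul, Finset.sum_add_distrib, ← Finset.mul_sum, hsumx, Finset.sum_const,
        Finset.card_range, nsmul_eq_mul]
      ring
    have h2 : ∑ j ∈ Finset.range J, K' * hφ * (X / 2 ^ (j + 1)) * E = K' * hφ * (X - X / 2 ^ J) * E := by
      rw [← hsumx, Finset.mul_sum, Finset.sum_mul]
    rw [h1, h2]
    have h3 : 0 ≤ K' * hφ * E := by positivity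
    have h4 : 0 ≤ 2 * δ * L ^ 2 := by positivity
    have h5 : (2 * δ * (X - X / 2 ^ J) + 2 * J) * L ^ 2 ≤ (2 * δ * X + 2 * J) * L ^ 2 := by
      refine mul_le_mul_of_nonneg_right ?_ (by positivity)
      have : 0 ≤ 2 * δ * (X / 2 ^ J) := by positivity
      linarith only [this]
    have h6 : K' * hφ * (X - X / 2 ^ J) * E ≤ K' * hφ * X * E := by
      refine mul_le_mul_of_nonneg_right (mul_le_mul_of_nonneg_left ?_ (by positivity)) hE0
      linarith only [hXJ0]
    exact add_le_add h5 h6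
  -- the initial segment
  have hinit : |∑ n ∈ Icc 1 ⌊X / 2 ^ J⌋₊, a n| ≤ X ^ (3999 / 4000 : ℝ) * L ^ 2 := by
    rw [abs_of_nonneg (Finset.sum_nonneg fun n _ => ha0 n)]
    calc ∑ n ∈ Icc 1 ⌊X / 2 ^ J⌋₊, a n ≤ ∑ n ∈ Icc 1 ⌊X / 2 ^ J⌋₊, L ^ 2 := by
          refine Finset.sum_le_sum fun n hn => ?_
          obtain ⟨hn1, hn2⟩ := Finset.mem_Icc.mp hn
          refine haL n hn1 (le_trans (le_trans (by exact_mod_cast hn2) (Nat.floor_le hXJ0)) ?_)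
          have : X / 2 ^ J ≤ X := div_le_self hX0.le (one_le_pow₀ one_le_two)
          linarith only [this, hX0]
      _ = (⌊X / 2 ^ J⌋₊ : ℝ) * L ^ 2 := by rw [Finset.sum_const, Nat.card_Icc, nsmul_eq_mul]; simp
      _ ≤ X ^ (3999 / 4000 : ℝ) * L ^ 2 := by
          refine mul_le_mul_of_nonneg_right ((Nat.floor_le hXJ0).trans hXJ.le) (by positivity)
  -- the main terms
  have hmainterm : |(X - X / 2 ^ J) * I * 𝔖 * (1 + corr) - X * 𝔖 * (1 + corr)| ≤
      12 * hφ * (X ^ (999 / 1000 : ℝ) + X ^ (3999 / 4000 : ℝ)) := by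
    have e : (X - X / 2 ^ J) * I * 𝔖 * (1 + corr) - X * 𝔖 * (1 + corr) =
        -((X * (1 - I) + X / 2 ^ J * I) * (𝔖 * (1 + corr))) := by ring
    rw [e, abs_neg, abs_mul, abs_mul]
    have h1 : |X * (1 - I) + X / 2 ^ J * I| ≤ X ^ (999 / 1000 : ℝ) + X ^ (3999 / 4000 : ℝ) := by
      have hI3 : 0 ≤ X * (1 - I) := mul_nonneg hX0.le (by linarith only [hI1])
      have hI4 : 0 ≤ X / 2 ^ J * I := mul_nonneg hXJ0 hI0
      rw [abs_of_nonneg (by linarith only [hI3, hI4])]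
      have hI5 : X * (1 - I) ≤ 2 * δ * X := by
        have := mul_le_mul_of_nonneg_left (show 1 - I ≤ 2 * δ by linarith only [hI2]) hX0.le
        linarith only [this]
      have hI6 : X / 2 ^ J * I ≤ X / 2 ^ J := mul_le_of_le_one_right hXJ0 hI1
      linarith only [hI5, hI6, hδX, hXJ]
    have h2 : |𝔖| * |1 + corr| ≤ 6 * hφ * 2 := by
      rw [abs_of_nonneg h𝔖0]
      exact mul_le_mul h𝔖le hcorr1 (abs_nonneg _) (by positivity)
    have h3 : 0 ≤ |𝔖| * |1 + corr| := by positivity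
    calc |X * (1 - I) + X / 2 ^ J * I| * (|𝔖| * |1 + corr|)
        ≤ (X ^ (999 / 1000 : ℝ) + X ^ (3999 / 4000 : ℝ)) * (6 * hφ * 2) :=
          mul_le_mul h1 h2 h3 (by positivity)
      _ = 12 * hφ * (X ^ (999 / 1000 : ℝ) + X ^ (3999 / 4000 : ℝ)) := by ring
  -- the polynomially small errors
  have hX99 : X ^ (999 / 1000 : ℝ) ≤ X ^ (3999 / 4000 : ℝ) := Real.rpow_le_rpow_of_exponent_le hX1 (by norm_num)
  have hX399_1 : 1 ≤ X ^ (3999 / 4000 : ℝ) := Real.one_le_rpow hX1 (by norm_num)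
  have hL3 : L ^ 3 ≤ 24000 ^ 3 * (3 + A) * X ^ (1 / 8000 : ℝ) := by
    have h1 := log_pow_three_le_rpow (show (0 : ℝ) < 1 / 8000 by norm_num) (show (1 : ℝ) ≤ (3 + A) * X by linarith)
    rw [← hL_def, Real.mul_rpow (by linarith) hX0.le] at h1
    have h2 : (3 + A) ^ (1 / 8000 : ℝ) ≤ 3 + A := by
      conv_rhs => rw [← Real.rpow_one (3 + A)]
      exact Real.rpow_le_rpow_of_exponent_le (by linarith) (by norm_num)
    have h3 : 0 ≤ X ^ (1 / 8000 : ℝ) := Real.rpow_nonneg hX0.le _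
    calc L ^ 3 ≤ (3 / (1 / 8000)) ^ 3 * ((3 + A) ^ (1 / 8000 : ℝ) * X ^ (1 / 8000 : ℝ)) := h1
      _ = 24000 ^ 3 * ((3 + A) ^ (1 / 8000 : ℝ) * X ^ (1 / 8000 : ℝ)) := by norm_num
      _ ≤ 24000 ^ 3 * ((3 + A) * X ^ (1 / 8000 : ℝ)) := by gcongr
      _ = 24000 ^ 3 * (3 + A) * X ^ (1 / 8000 : ℝ) := by ring
  have hstuff : X ^ (3999 / 4000 : ℝ) * L ^ 2 + (2 * δ * X + 2 * J) * L ^ 2 +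
      12 * hφ * (X ^ (999 / 1000 : ℝ) + X ^ (3999 / 4000 : ℝ)) ≤ KA * hφ * X * X ^ (-(1 / 8000 : ℝ)) := by
    rw [hδX]
    have hpoly := poly_errors_le hX399_1 hX99 hL1 hhφ1 hJL
    have hX' : X ^ (3999 / 4000 : ℝ) * X ^ (1 / 8000 : ℝ) = X * X ^ (-(1 / 8000 : ℝ)) := by
      rw [← Real.rpow_add hX0, show (3999 / 4000 : ℝ) + 1 / 8000 = 1 + -(1 / 8000) by norm_num,
        Real.rpow_add hX0, Real.rpow_one]
    have h4 : 30 * hφ * L ^ 3 * X ^ (3999 / 4000 : ℝ) ≤ KA * hφ * X * X ^ (-(1 / 8000 : ℝ)) := by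
      have hφ0 : 0 ≤ hφ := by linarith only [hhφ1]
      calc 30 * hφ * L ^ 3 * X ^ (3999 / 4000 : ℝ)
          ≤ 30 * hφ * (24000 ^ 3 * (3 + A) * X ^ (1 / 8000 : ℝ)) * X ^ (3999 / 4000 : ℝ) :=
            mul_le_mul_of_nonneg_right (mul_le_mul_of_nonneg_left hL3 (by positivity))
              (Real.rpow_nonneg hX0.le _)
        _ = KA * hφ * (X ^ (3999 / 4000 : ℝ) * X ^ (1 / 8000 : ℝ)) := by rw [hKA]; ring
        _ = KA * hφ * X * X ^ (-(1 / 8000 : ℝ)) := by rw [hX']; ring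
    exact hpoly.trans h4
  have habsorb : KA * hφ * X * X ^ (-(1 / 8000 : ℝ)) ≤ KA * Kabs * hφ * X * E := by
    have h1 := Habs X hX3
    calc KA * hφ * X * X ^ (-(1 / 8000 : ℝ)) ≤ KA * hφ * X * (Kabs * Real.exp (-C * Real.log X ^ (3 / 5 - ε))) :=
          mul_le_mul_of_nonneg_left h1 (by positivity)
      _ ≤ KA * hφ * X * (Kabs * E) := by gcongr
      _ = KA * Kabs * hφ * X * E := by ring
  -- assemble
  rw [sum_Icc_eq_sum_add_sum_dyadic a hX0.le J]
  have e : (∑ n ∈ Icc 1 ⌊X / 2 ^ J⌋₊, a n) +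
      (∑ j ∈ Finset.range J, ∑ n ∈ Ioc ⌊X / 2 ^ (j + 1)⌋₊ ⌊X / 2 ^ j⌋₊, a n) - X * 𝔖 * (1 + corr) =
      (∑ n ∈ Icc 1 ⌊X / 2 ^ J⌋₊, a n) +
      ((∑ j ∈ Finset.range J, ∑ n ∈ Ioc ⌊X / 2 ^ (j + 1)⌋₊ ⌊X / 2 ^ j⌋₊, a n) -
        (X - X / 2 ^ J) * I * 𝔖 * (1 + corr)) +
      ((X - X / 2 ^ J) * I * 𝔖 * (1 + corr) - X * 𝔖 * (1 + corr)) := by ring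
  rw [e]
  calc |(∑ n ∈ Icc 1 ⌊X / 2 ^ J⌋₊, a n) +
        ((∑ j ∈ Finset.range J, ∑ n ∈ Ioc ⌊X / 2 ^ (j + 1)⌋₊ ⌊X / 2 ^ j⌋₊, a n) -
          (X - X / 2 ^ J) * I * 𝔖 * (1 + corr)) +
        ((X - X / 2 ^ J) * I * 𝔖 * (1 + corr) - X * 𝔖 * (1 + corr))|
      ≤ |∑ n ∈ Icc 1 ⌊X / 2 ^ J⌋₊, a n| +
        |(∑ j ∈ Finset.range J, ∑ n ∈ Ioc ⌊X / 2 ^ (j + 1)⌋₊ ⌊X / 2 ^ j⌋₊, a n) -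
          (X - X / 2 ^ J) * I * 𝔖 * (1 + corr)| +
        |(X - X / 2 ^ J) * I * 𝔖 * (1 + corr) - X * 𝔖 * (1 + corr)| := abs_add_three _ _ _
    _ ≤ X ^ (3999 / 4000 : ℝ) * L ^ 2 + ((2 * δ * X + 2 * J) * L ^ 2 + K' * hφ * X * E) +
        12 * hφ * (X ^ (999 / 1000 : ℝ) + X ^ (3999 / 4000 : ℝ)) := add_le_add (add_le_add hinit hblocks) hmainterm
    _ ≤ K' * hφ * X * E + KA * Kabs * hφ * X * E := by linarith [hstuff, habsorb]
    _ = (K' + KA * Kabs) * ((h : ℝ) / (Nat.totient h : ℝ)) * X *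
        (Real.exp (-C * Real.sqrt (V * Real.log η)) + Real.exp (-C * Real.log X ^ (3 / 5 - ε)) +
          V * Real.log η ^ (6 : ℕ) / η) := by rw [hhφ, hE_def]; ring

end Literature.Barriers.Parity
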